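import Summits.NavierStokesRegularity.NavierStokesRegularity.Theses.RellichScar
import Summits.NavierStokesRegularity.NavierStokesRegularity.Theorems.TypeIDSSLiouvilleConjecture
import Summits.NavierStokesRegularity.NavierStokesRegularity.Theorems.SymmetricScarExists.Negative.SpiralWorld
import Summits.NavierStokesRegularity.NavierStokesRegularity.Theorems.SymmetricScarExists.Negative.RepairedAssembly
import Summits.NavierStokesRegularity.NavierStokesRegularity.Theorems.SymmetricScarExists.Negative.TargetCostume
import Summits.NavierStokesRegularity.NavierStokesRegularity.Theorems.SymmetricScarExists.Negative.RdssWall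
import Summits.NavierStokesRegularity.NavierStokesRegularity.Theorems.RellichScarSimilarityCovariance
import Summits.NavierStokesRegularity.NavierStokesRegularity.Theorems.RellichScarSelfSimilarApexFatal
import Summits.NavierStokesRegularity.NavierStokesRegularity.Theorems.RellichScarAxisymmetricApexFatal
import Summits.NavierStokesRegularity.NavierStokesRegularity.Theorems.RellichScarSymmetricScarExistsDssNearOne
import Summits.NavierStokesRegularity.NavierStokesRegularity.Theorems.RellichScarSymmetricScarExistsRdssRobustSlowScrew
import Summits.NavierStokesRegularity.NavierStokesRegularity.Theorems.RellichScarSymmetricScarExistsRdssCalibrations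
import Summits.NavierStokesRegularity.NavierStokesRegularity.Theorems.RellichScarSymmetricScarExistsSmallConstant
import Summits.NavierStokesRegularity.NavierStokesRegularity.Theorems.RellichScarSymmetricScarExistsDilationContinuity
import Summits.NavierStokesRegularity.NavierStokesRegularity.Theorems.RellichScarSymmetricScarExistsIrrationalRotationApexFatal
import Summits.NavierStokesRegularity.NavierStokesRegularity.Theorems.RellichScarSymmetricScarExistsRotInvariantLimit
import Summits.NavierStokesRegularity.NavierStokesRegularity.Theorems.RellichScarSymmetricScarExistsRotationNormalForm
import Summits.NavierStokesRegularity.NavierStokesRegularity.Theorems.RellichScarSymmetricScarExistsAnyAxisScrewWitness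
import Summits.NavierStokesRegularity.NavierStokesRegularity.Theorems.RellichScarSymmetricScarExistsIrrationalScarRotation
import Summits.NavierStokesRegularity.NavierStokesRegularity.Theorems.RellichScarSymmetricScarExistsRotWindowRigidity
import Summits.NavierStokesRegularity.NavierStokesRegularity.Theorems.RellichScarSymmetricScarExistsScaleWindowRigidity
import Summits.NavierStokesRegularity.NavierStokesRegularity.Theorems.RellichScarSymmetricScarExistsOrbitScarRigidity
import Summits.NavierStokesRegularity.NavierStokesRegularity.Theorems.RellichScarSymmetricScarExistsScarStabiliserClosed
import Summits.NavierStokesRegularity.NavierStokesRegularity.Theorems.RellichScarSymmetricScarExistsClosedSubgroupPlaneLine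
import Summits.NavierStokesRegularity.NavierStokesRegularity.Theorems.RellichScarSymmetricScarExistsRotationOrbitContinuity
import Summits.NavierStokesRegularity.NavierStokesRegularity.Theorems.RellichScarSymmetricScarExistsScrewInvariantLimitMoving

/-!
# Line `rdss-screw-split` for the crux `SymmetricScarExists` (stmt-NavierStokesRegularity-11718)

v4 (lead c4, 2026-08-17, after waves 2–4): stubs A/B/C and the composition are UNCHANGED (byte-identical with the children file);
ALL TEN auxiliary stubs AUX-1…AUX-10 are LANDED and wired below (p142138 p140542 p141219 p141666 p141350 p142130 p143198 p143193
p143872 p143797) and the lead's assemblies are landed/proposed as Theorems files (p142730 AnyAngleNearOne, p144253 ScarStabiliserDichotomy,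
p144268 NearIrrationalDirection).  Original v2 note:
a section "Auxiliary registered stubs (lead c4)" adds six provable auxiliary stubs — the near-identity corner of
child C in EVERY direction of the screw group (fixed angle `θ`, `c ↓ 1`: compactness ⇒ pure-rotation symmetry
⇒ axisymmetry for irrational `θ/2π` ⇒ Seregin–Šverák; rational angles by the landed rational corner) and the
`SO(3)` any-axis bookkeeping asked for in Disproof §10.

Crux-strategist SKELETON (cstrat gen 1, wall-breaker on the exhausted chain; v1 2026-08-17).  This line is a
TYPED DECOMPOSITION of the crux filed in line form (the gate offers `route edit --split` to a seat only on its
final cycle; the strategist's direct split was refused for that reason, and `Theorems/` is prover-only): its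
three open stubs ARE the intended sub-cruxes, its composition IS the split glue, and its terminal state is the
SPLIT `SymmetricScarExists ⇐ RdssScarSelection ∧ RdssScarRigidity ∧ RdssApexFatal` (children file
`Cruxes/SymmetricScarExists/Lines/rdss-screw-split-children.md (JSON block)`, glue-by the landed copy of
`SymmetricScarExists_of`), not a proof of the crux inside one seat.  Card: `Lines/rdss-screw-split.md`;
census: `STRATEGY-CENSUS.md`.

WHY THIS CUT (diagnosis of the dead lines, all kernel-checked in the tree): the crux `S` is X-sandwiched —
`X → S → (ScarRigidity → X)` (`Negative.TargetCostume`, p71696) — so every SINGLE-residual line for `S` is a line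
for the target `X = NoApexTypeIProfile` on the apex class and therefore contains the Type-I (R)DSS Liouville wall
for all factors (`flatSource ⇔ S`, p103671; `oneGoodSlice ⇒ X`, p107809; `stub_rssLiouville` = P–V Conj. 1.1).
The crux's dichotomy "(−1)-homogeneous ∨ axisymmetric scar" asks the zoom dynamics for a FIXED POINT, while the
compact orbits of `ℝ₊ × SO(2)` on scars — the only symmetric objects recurrence/closing can output — are the
SCREW-PERIODIC (rotated discretely self-similar) ones (Disproof §4–§5, §9: `Negative.SpiralField`,
`Negative.SelectionSkeleton`).  The cut below separates the three technique classes the crux conflates, each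
child STRICTLY WEAKER than an existing route statement (calibrations proved in this file):

* STUB A `stub_rdssScarSelection` (BET-select; child `RdssScarSelection`; weaker than `S`:
  `rdssScarSelection_of_symmetricScarExists`): ∃ singular apex profile ⇒ ∃ one whose SCAR is fixed by ONE
  screw-dilation `x ↦ c R_θ x`, `c > 1`, or is axisymmetric.  Engines: equivariant Katok/Lian–Young closing
  under hyperbolic zoom statistics (idea katok-closing-rdss, triage-passed ×3, never planned); asymptotic
  screw-periodicity of the emission `F(ŷ, −2 log|x|)` at `|x| → 0/∞` (blow-up / blow-down of the scar);
  Chae 2015 (arXiv:1306.0305) for the asymptotically-DSS notion in `L^q` classes.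
* STUB B `stub_rdssScarRigidity` (BET-rigidity; child `RdssScarRigidity`; weaker than `ScarRigidity`:
  `rdssScarRigidity_of_scarRigidity`): a singular apex profile whose scar is fixed by a screw-dilation `g`
  (`c > 1`) is a.e. fixed by `g` — backward uniqueness across the apex for the pair `(u, g·u)` only; the
  route's `closes` consumes `ScarRigidity` only through such orbit-internal pairs.
* STUB C `stub_rdssApexFatal` (WALL; child `RdssApexFatal`; weaker than `X`:
  `rdssApexFatal_of_noApexTypeIProfile`): no singular apex profile is a.e. fixed by a screw-dilation with
  `c > 1` — Bradshaw–Tsai 2017 OP 5.1 / Tsai GSM 192 Conj. 8.8–8.9 about `e₃` in apex-class form.  LANDED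
  CORNERS: `dssApexFatal_nearOne` (θ = 0, `c` near 1, p105416; restated below as
  `rdssApexFatal_corner_untwisted_nearOne`), `rssApexFatal_smallOrLargePitch` (p107737).  It CONTAINS Perelman's
  RSS problem (`rssApexFatal_of_rdssApexFatal`) and Leray–Tsai SS exclusion
  (`selfSimilar_hypothesis_of_rdssApexFatal`).  OPEN in the middle (large factors, mid pitch): an open
  problem of the field, declared — it is to become an ITEM at the split, never to be attacked as a stub.
* NOT A STUB (provable by-product for the lead, M): the WALL BRIDGE — the canonical tree conjecture
  `Summit.NavierStokesRegularity.NavierStokesRegularity.TypeIDSSLiouvilleConjecture` (imported here) implies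
  STUB C: apex ⇒ Type-I ancient mild representative (`stub_apexMildRepresentative`, landed) ⇒ the a.e. screw
  identity holds pointwise on the open slab (continuity, as in `ScarWindow.dssApexFatal_nearOne`) ⇒ truncation
  to `t ≥ 0` is exactly `IsRotatedDSS c (Negative.rotZIso (−θ))` ⇒ wall ⇒ slices a.e. zero ⇒
  `Negative.not_isBackwardSingularPoint_of_slices_ae_zero`.  It pins child C to the obligation shared by 25
  routes of the sub-problem; it is not registered because it is not load-bearing for `SymmetricScarExists_of`.

Composition: `SymmetricScarExists_of : A → B → C → SymmetricScarExists` (the crux BY NAME; = the split glue).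
Calibration: `rdssScarSelection_iff_noApexTypeIProfile` — granting `ScarRigidity` and C, A ⇔ X (the costume one
level down, stated openly: the split separates technique classes; it does not weaken their conjunction).

Disproof used (`Cruxes/SymmetricScarExists/Disproof.lean`, gen 3): §6 `symmetricScarExists_false_without_singularAntecedent`
— honoured: every stub keeps `IsBackwardSingularPoint u 0` in antecedent AND consequent; §7 conclusion
load-bearing only through "NSE ∧ singular" — honoured (A's witness is a suitable weak NS solution, singular);
§8 target costume — answered by the cut itself (A alone is not X-equivalent by any tree theorem; A ∧ B ∧ C is, as
it must be); §9 selection skeleton false — honoured: A asks for a screw-PERIODIC scar, the object §9's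
counterexample (RSS scar orbit = circle) HAS (`IsSpiralRSS.dss`); §4 spiral world — in that world A is TRUE (the RSS profile is its own witness), B holds for the RSS screws
themselves and can fail only as `ScarRigidity` does (emission with a symmetry the core lacks: a dark breather),
and C is FALSE — i.e. the line localises the crux's failure mode in the wall, where it belongs; §11 only `C > 0`
matters — unchanged.  No landed `Negative/` lemma refutes an instance of A–C (checked: LocalTypeIBarrier,
SpiralWorld, SpiralField, RepairedAssembly, LoadBearingSingularAntecedent, RdssWall, ConclusionLoadBearing,
TargetCostume, SelectionSkeleton, OneGoodSlice×4).
-/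

noncomputable section

open MeasureTheory Set Function Filter Topology TopologicalSpace Metric
open scoped NNReal ENNReal

namespace Summit.NavierStokesRegularity.NavierStokesRegularity.Cruxes.SymmetricScarExists.RdssScrewSplit

open Literature.Analysis.FluidPDE
open Summit.NavierStokesRegularity.NavierStokesRegularity.Theses.RellichScar
open Summit.NavierStokesRegularity.NavierStokesRegularity.Theorems.SymmetricScarExists.Negative
open Summit.NavierStokesRegularity.NavierStokesRegularity.Theorems.SymmetricScarExists.ScarWindow

set_option linter.dupNamespace false

/-! ## Registered stubs -/

/-- STUB A — BET-select (`RdssScarSelection`, child 1 of the split).  If a singular apex profile exists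
(constant `C`), then for some `C'` there is a singular apex profile whose scar is fixed by ONE screw-dilation
`(c, θ)` with `c > 1` — `ess sup_{(−δ,0)×K} |R_θ D_c u − u| → 0` as `δ ↓ 0` for every compact `K ∌ 0` — or is
axisymmetric about `e₃`. -/
theorem stub_rdssScarSelection :
    ∀ C : ℝ, (∃ (u : ℝ → EuclideanSpace ℝ (Fin 3) → EuclideanSpace ℝ (Fin 3)) (p : ℝ → EuclideanSpace ℝ (Fin 3) → ℝ) (G : ℝ → EuclideanSpace ℝ (Fin 3) → EuclideanSpace ℝ (Fin 3) →L[ℝ] EuclideanSpace ℝ (Fin 3)), Literature.Analysis.FluidPDE.IsSuitableWeakSolutionOn (Literature.Analysis.FluidPDE.slab (EuclideanSpace ℝ (Fin 3)) (Set.Iio 0) isOpen_Iio) 1 0 u p ∧ Literature.Analysis.FluidPDE.HasWeakSpatialGradientOn (Literature.Analysis.FluidPDE.slab (EuclideanSpace ℝ (Fin 3)) (Set.Iio 0) isOpen_Iio) u G ∧ Literature.Analysis.FluidPDE.typeIBound (Set.Iio (0 : ℝ) ×ˢ Set.univ) u p G < ⊤ ∧ Literature.Analysis.FluidPDE.HasTypeIDecay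 C u ∧ Literature.Analysis.FluidPDE.IsBackwardSingularPoint u 0) → ∃ (C' : ℝ) (u : ℝ → EuclideanSpace ℝ (Fin 3) → EuclideanSpace ℝ (Fin 3)) (p : ℝ → EuclideanSpace ℝ (Fin 3) → ℝ) (G : ℝ → EuclideanSpace ℝ (Fin 3) → EuclideanSpace ℝ (Fin 3) →L[ℝ] EuclideanSpace ℝ (Fin 3)), Literature.Analysis.FluidPDE.IsSuitableWeakSolutionOn (Literature.Analysis.FluidPDE.slab (EuclideanSpace ℝ (Fin 3)) (Set.Iio 0) isOpen_Iio) 1 0 u p ∧ Literature.Analysis.FluidPDE.HasWeakSpatialGradientOn (Literature.Analysis.FluidPDE.slab (EuclideanSpace ℝ (Fin 3)) (Set.Iio 0) isOpen_Iio) u G ∧ Literature.Analysis.FluidPDE.typeIBound (Set.Iio (0 : ℝ) ×ˢ Set.univ) u p G < ⊤ ∧ Literature.Analysis.FluidPDE.HasTypeIDecay C' u ∧ Literature.Analysis.FluidPDE.IsBackwardSingularPoint u 0 ∧ ((∃ c θ : ℝ, 1 < c ∧ ∀ K : Set (EuclideanSpace ℝ (Fin 3)), IsCompact K → (0 : EuclideanSpace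 ℝ (Fin 3)) ∉ K → Filter.Tendsto (fun δ : ℝ => MeasureTheory.eLpNorm (Function.uncurry (fun t x => Literature.Analysis.FluidPDE.rotZ θ (Literature.Analysis.FluidPDE.nsRescale c u t (Literature.Analysis.FluidPDE.rotZ (-θ) x))) - Function.uncurry u) ⊤ (MeasureTheory.volume.restrict (Set.Ioo (-δ) 0 ×ˢ K))) (nhdsWithin 0 (Set.Ioi 0)) (nhds 0)) ∨ (∀ θ : ℝ, ∀ K : Set (EuclideanSpace ℝ (Fin 3)), IsCompact K → (0 : EuclideanSpace ℝ (Fin 3)) ∉ K → Filter.Tendsto (fun δ : ℝ => MeasureTheory.eLpNorm (Function.uncurry (fun t x => Literature.Analysis.FluidPDE.rotZ θ (u t (Literature.Analysis.FluidPDE.rotZ (-θ) x))) - Function.uncurry u) ⊤ (MeasureTheory.volume.restrict (Set.Ioo (-δ) 0 ×ˢ K))) (nhdsWithin 0 (Set.Ioi 0)) (nhds 0))) := by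
  sorry

/-- STUB B — BET-rigidity (`RdssScarRigidity`, child 2).  A singular apex profile whose scar is fixed by the
screw-dilation `(c, θ)`, `c > 1`, is a.e. fixed by it on the slab. -/
theorem stub_rdssScarRigidity :
    ∀ (u : ℝ → EuclideanSpace ℝ (Fin 3) → EuclideanSpace ℝ (Fin 3)) (p : ℝ → EuclideanSpace ℝ (Fin 3) → ℝ) (G : ℝ → EuclideanSpace ℝ (Fin 3) → EuclideanSpace ℝ (Fin 3) →L[ℝ] EuclideanSpace ℝ (Fin 3)) (C c θ : ℝ), Literature.Analysis.FluidPDE.IsSuitableWeakSolutionOn (Literature.Analysis.FluidPDE.slab (EuclideanSpace ℝ (Fin 3)) (Set.Iio 0) isOpen_Iio) 1 0 u p → Literature.Analysis.FluidPDE.HasWeakSpatialGradientOn (Literature.Analysis.FluidPDE.slab (EuclideanSpace ℝ (Fin 3)) (Set.Iio 0) isOpen_Iio) u G → Literature.Analysis.FluidPDE.typeIBound (Set.Iio (0 : ℝ) ×ˢ Set.univ) u p G < ⊤ → Literature.Analysis.FluidPDE.HasTypeIDecay C u → Literature.Analysis.FluidPDE.IsBackwardSingularPoint u 0 → 1 <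 c → (∀ K : Set (EuclideanSpace ℝ (Fin 3)), IsCompact K → (0 : EuclideanSpace ℝ (Fin 3)) ∉ K → Filter.Tendsto (fun δ : ℝ => MeasureTheory.eLpNorm (Function.uncurry (fun t x => Literature.Analysis.FluidPDE.rotZ θ (Literature.Analysis.FluidPDE.nsRescale c u t (Literature.Analysis.FluidPDE.rotZ (-θ) x))) - Function.uncurry u) ⊤ (MeasureTheory.volume.restrict (Set.Ioo (-δ) 0 ×ˢ K))) (nhdsWithin 0 (Set.Ioi 0)) (nhds 0)) → Function.uncurry (fun t x => Literature.Analysis.FluidPDE.rotZ θ (Literature.Analysis.FluidPDE.nsRescale c u t (Literature.Analysis.FluidPDE.rotZ (-θ) x))) =ᵐ[MeasureTheory.volume.restrict (Set.Iio (0 : ℝ) ×ˢ Set.univ)] Function.uncurry u := by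
  sorry

/-- STUB C — THE WALL in apex form (`RdssApexFatal`, child 3; Bradshaw–Tsai 2017 OP 5.1 / Tsai Conj. 8.8–8.9
about `e₃`; OPEN for large factors and mid pitch — to become an item at the split, corners landed). -/
theorem stub_rdssApexFatal :
    ∀ (u : ℝ → EuclideanSpace ℝ (Fin 3) → EuclideanSpace ℝ (Fin 3)) (p : ℝ → EuclideanSpace ℝ (Fin 3) → ℝ) (G : ℝ → EuclideanSpace ℝ (Fin 3) → EuclideanSpace ℝ (Fin 3) →L[ℝ] EuclideanSpace ℝ (Fin 3)) (C c θ : ℝ), Literature.Analysis.FluidPDE.IsSuitableWeakSolutionOn (Literature.Analysis.FluidPDE.slab (EuclideanSpace ℝ (Fin 3)) (Set.Iio 0) isOpen_Iio) 1 0 u p → Literature.Analysis.FluidPDE.HasWeakSpatialGradientOn (Literature.Analysis.FluidPDE.slab (EuclideanSpace ℝ (Fin 3)) (Set.Iio 0) isOpen_Iio) u G → Literature.Analysis.FluidPDE.typeIBound (Set.Iio (0 : ℝ) ×ˢ Set.univ) u p G < ⊤ → Literature.Analysis.FluidPDE.HasTypeIDecay C u → Literature.Analysis.FluidPDE.IsBackwardSingularPoint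 u 0 → 1 < c → Function.uncurry (fun t x => Literature.Analysis.FluidPDE.rotZ θ (Literature.Analysis.FluidPDE.nsRescale c u t (Literature.Analysis.FluidPDE.rotZ (-θ) x))) =ᵐ[MeasureTheory.volume.restrict (Set.Iio (0 : ℝ) ×ˢ Set.univ)] Function.uncurry u → False := by
  sorry

/-! ## Auxiliary registered stubs (lead c4, 2026-08-17): "every screw DIRECTION is fatal near the identity"

The landed corners of child C near the identity of the screw group `ℝ₊ × SO(2)` are CONES at the identity
(`rdssApexFatal_pineauVicol_slow`: `|θ| ≤ 2α₁ log c`; `rdssApexFatal_rationalAngle_nearOne`: `q θ ∈ 2πℤ`,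
`c^q < c₁`).  The auxiliary stubs below close the remaining directions: a FIXED angle `θ` and `c ↓ 1`.
Mechanism (compactness ⇒ symmetry enhancement ⇒ Seregin–Šverák): if singular apex profiles `u_k`
(constant `C`, `𝐈 ≤ I`) are fixed by the screws `(c_k, θ)` with `c_k ↓ 1`, an `L³_loc` limit (`slabLimit_le`) is
a singular apex profile fixed by the PURE ROTATION `R_θ` (AUX-2 + AUX-3); for `θ/2π` irrational the closed
stabiliser then contains a dense subgroup of `SO(2)`, so the limit is a.e. axisymmetric and the landed
`AxisymmetricApexFatal` kills it (AUX-1); for `θ/2π = m/q` rational the landed rational corner applies for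
`c < c₁^{1/q}`.  Net (lead's assembly, this cycle): `∀ C I θ, ∃ c_* > 1, ∀ c ∈ (1, c_*)`, C holds at `(c, θ)`
(for `𝐈 ≤ I`).  AUX-4/5 are the `SO(3)` bookkeeping the Disproof (§10) asks for: a screw about ANY axis is
conjugate to an `e₃`-screw, so child A accepts witnesses about any axis and child C transfers to any axis.
AUX-6 is the scar-level twin of AUX-1: an irrationally rotation-symmetric SCAR is axisymmetric (⇒ `S` (b)). -/

/-- AUX-1 `stub_irrationalRotationApexFatal` — **a singular apex profile is not a.e. invariant under a
rotation by an irrational angle** (the pure-rotation case `c = 1` excluded from B/C): with the continuous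
(mild) representative the stabiliser `{φ | R_φ V(t, R_{−φ}x) = V(t,x)}` is a closed subgroup of `ℝ`
containing `θ` and `2π`, hence `ℝ` when `θ/2π ∉ ℚ` (`AddSubgroup.dense_or_cyclic`); then
`rellichScar_axisymmetricApexFatal_proof`. -/
theorem stub_irrationalRotationApexFatal :
    ∀ (u : ℝ → EuclideanSpace ℝ (Fin 3) → EuclideanSpace ℝ (Fin 3)) (p : ℝ → EuclideanSpace ℝ (Fin 3) → ℝ) (G : ℝ → EuclideanSpace ℝ (Fin 3) → EuclideanSpace ℝ (Fin 3) →L[ℝ] EuclideanSpace ℝ (Fin 3)) (C θ : ℝ), Literature.Analysis.FluidPDE.IsSuitableWeakSolutionOn (Literature.Analysis.FluidPDE.slab (EuclideanSpace ℝ (Fin 3)) (Set.Iio 0) isOpen_Iio) 1 0 u p → Literature.Analysis.FluidPDE.HasWeakSpatialGradientOn (Literature.Analysis.FluidPDE.slab (EuclideanSpace ℝ (Fin 3)) (Set.Iio 0) isOpen_Iio) u G → Literature.Analysis.FluidPDE.typeIBound (Set.Iio (0 : ℝ) ×ˢ Set.univ) u p G < ⊤ → Literature.Analysis.FluidPDE.HasTypeIDecay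 C u → Literature.Analysis.FluidPDE.IsBackwardSingularPoint u 0 → Irrational (θ / (2 * Real.pi)) → Function.uncurry (fun t x => Literature.Analysis.FluidPDE.rotZ θ (u t (Literature.Analysis.FluidPDE.rotZ (-θ) x))) =ᵐ[MeasureTheory.volume.restrict (Set.Iio (0 : ℝ) ×ˢ Set.univ)] Function.uncurry u → False :=
  Summit.NavierStokesRegularity.NavierStokesRegularity.Theorems.SymmetricScarExists.RdssSplit.NearIdentity.stub_irrationalRotationApexFatal

/-- AUX-2 `stub_dilationContinuity` — **continuity of the parabolic dilation in `L³(Q(0,R))`** at a field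
with `u ∈ L³(Q(0,R))` for every `R`: `‖c_j u(c_j² t, c_j x) − u(t,x)‖_{L³(Q(0,R))} → 0` when `c_j → 1`
(density of continuous compactly supported fields in `L³`, uniform continuity, and the exact scaling law
`eLpNorm_zoom_sub_zoom` / `eLpNorm_screw_sub_screw` at `θ = 0` for the remainder). [folklore] -/
theorem stub_dilationContinuity :
    ∀ (u : ℝ → EuclideanSpace ℝ (Fin 3) → EuclideanSpace ℝ (Fin 3)), (∀ R : ℝ, 0 < R → MeasureTheory.MemLp (Function.uncurry u) 3 (MeasureTheory.volume.restrict (Literature.Analysis.FluidPDE.parabolicCylinder R (0 : ℝ × EuclideanSpace ℝ (Fin 3))))) → ∀ (c : ℕ → ℝ), (∀ j : ℕ, 0 < c j) → Filter.Tendsto c Filter.atTop (nhds 1) → ∀ R : ℝ, 0 < R → Filter.Tendsto (fun j : ℕ => MeasureTheory.eLpNorm (Function.uncurry (Literature.Analysis.FluidPDE.nsRescale (c j) u) - Function.uncurry u) 3 (MeasureTheory.volume.restrict (Literature.Analysis.FluidPDE.parabolicCylinder R (0 : ℝ × EuclideanSpace ℝ (Fin 3))))) Filter.atTop (nhds 0)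 :=
  Summit.NavierStokesRegularity.NavierStokesRegularity.Theorems.SymmetricScarExists.RdssSplit.NearIdentity.stub_dilationContinuity

/-- AUX-3 `stub_rotInvariantLimit` — **screw invariance with factors `c_j → 1` becomes rotation invariance in
the `L³_loc` limit**: if `V_j → u` in every `L³(Q(0,R))`, each `V_j` is a.e. fixed on the slab by the screw
`(c_j, θ)`, `c_j → 1`, and the dilations `D_{c_j} u → u` in every `L³(Q(0,R))` (AUX-2), then
`R_θ u(t, R_{−θ} x) = u(t, x)` a.e. on the slab (four-term splitting as in
`Robust.screw_ae_eq_of_defect_tendsto_zero`, exhaustion of the slab by the balls `Q(0, n+1)`). [folklore] -/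
theorem stub_rotInvariantLimit :
    ∀ (θ : ℝ) (c : ℕ → ℝ) (V : ℕ → ℝ → EuclideanSpace ℝ (Fin 3) → EuclideanSpace ℝ (Fin 3)) (u : ℝ → EuclideanSpace ℝ (Fin 3) → EuclideanSpace ℝ (Fin 3)), (∀ j : ℕ, 0 < c j) → Filter.Tendsto c Filter.atTop (nhds 1) → (∀ (j : ℕ) (r : ℝ), 0 < r → ∀ R : ℝ, 0 < R → MeasureTheory.AEStronglyMeasurable (Function.uncurry (Literature.Analysis.FluidPDE.nsRescale r (V j))) (MeasureTheory.volume.restrict (Literature.Analysis.FluidPDE.parabolicCylinder R (0 : ℝ × EuclideanSpace ℝ (Fin 3))))) → (∀ (r : ℝ), 0 < r → ∀ R : ℝ, 0 < R → MeasureTheory.AEStronglyMeasurable (Function.uncurry (Literature.Analysis.FluidPDE.nsRescale r u)) (MeasureTheory.volume.restrict (Literature.Analysis.FluidPDE.parabolicCylinder R (0 : ℝ × EuclideanSpace ℝ (Fin 3))))) → (∀ R : ℝ, 0 < R → Filter.Tendsto (fun j : ℕ => MeasureTheory.eLpNorm (Function.uncurry (V j) - Function.uncurry u) 3 (MeasureTheory.volume.restrict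 (Literature.Analysis.FluidPDE.parabolicCylinder R (0 : ℝ × EuclideanSpace ℝ (Fin 3))))) Filter.atTop (nhds 0)) → (∀ R : ℝ, 0 < R → Filter.Tendsto (fun j : ℕ => MeasureTheory.eLpNorm (Function.uncurry (Literature.Analysis.FluidPDE.nsRescale (c j) u) - Function.uncurry u) 3 (MeasureTheory.volume.restrict (Literature.Analysis.FluidPDE.parabolicCylinder R (0 : ℝ × EuclideanSpace ℝ (Fin 3))))) Filter.atTop (nhds 0)) → (∀ j : ℕ, Function.uncurry (fun t x => Literature.Analysis.FluidPDE.rotZ θ (Literature.Analysis.FluidPDE.nsRescale (c j) (V j) t (Literature.Analysis.FluidPDE.rotZ (-θ) x))) =ᵐ[MeasureTheory.volume.restrict (Set.Iio (0 : ℝ) ×ˢ Set.univ)] Function.uncurry (V j)) → Function.uncurry (fun t x => Literature.Analysis.FluidPDE.rotZ θ (u t (Literature.Analysis.FluidPDE.rotZ (-θ) x))) =ᵐ[MeasureTheory.volume.restrict (Set.Iio (0 : ℝ) ×ˢ Set.univ)] Function.uncurry u :=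
  Summit.NavierStokesRegularity.NavierStokesRegularity.Theorems.SymmetricScarExists.RdssSplit.NearIdentity.stub_rotInvariantLimit

/-- AUX-4 `stub_rotationNormalForm` — **Euler's rotation theorem as a normal form**: every
orientation-preserving linear isometry of `ℝ³` is conjugate, by a linear isometry, to a rotation `R_θ` about
the `x₃`-axis (real eigenvalue `1` in odd dimension with `det = 1`; the orthogonal complement of the axis is an
invariant plane on which the map is a rotation, `Orientation.exists_linearIsometryEquiv_eq_of_det_pos`).
[folklore] -/
theorem stub_rotationNormalForm :
    ∀ R : EuclideanSpace ℝ (Fin 3) ≃ₗᵢ[ℝ] EuclideanSpace ℝ (Fin 3), 0 < LinearMap.det (R.toLinearEquiv : EuclideanSpace ℝ (Fin 3) →ₗ[ℝ] EuclideanSpace ℝ (Fin 3)) → ∃ (Q : EuclideanSpace ℝ (Fin 3) ≃ₗᵢ[ℝ] EuclideanSpace ℝ (Fin 3)) (θ : ℝ), ∀ x : EuclideanSpace ℝ (Fin 3), R x = Q (Literature.Analysis.FluidPDE.rotZ θ (Q.symm x)) :=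
  Summit.NavierStokesRegularity.NavierStokesRegularity.Theorems.SymmetricScarExists.RdssSplit.AnyAxis.stub_rotationNormalForm

/-- AUX-5 `stub_anyAxisScrewWitness` — **child A accepts screw-invariant profiles about ANY axis**: if a
singular apex profile is a.e. fixed on the slab by `u ↦ R (c u(c²t, c R⁻¹x))`, `c > 1`, for a linear isometry
`R` in normal form `R = Q R_θ Q⁻¹`, then the conjugate `Q⁻¹ u(t, Q x)` is a singular apex profile (same `C`,
`RellichScarSimilarityCovariance.apexClass_conj`) a.e. fixed by the `e₃`-screw `(c, θ)`, hence A's conclusion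
holds (`rdssScarSelection_witness_of_aeScrewInvariant`). [folklore] -/
theorem stub_anyAxisScrewWitness :
    ∀ (u : ℝ → EuclideanSpace ℝ (Fin 3) → EuclideanSpace ℝ (Fin 3)) (p : ℝ → EuclideanSpace ℝ (Fin 3) → ℝ) (G : ℝ → EuclideanSpace ℝ (Fin 3) → EuclideanSpace ℝ (Fin 3) →L[ℝ] EuclideanSpace ℝ (Fin 3)) (C c θ : ℝ) (R Q : EuclideanSpace ℝ (Fin 3) ≃ₗᵢ[ℝ] EuclideanSpace ℝ (Fin 3)), Literature.Analysis.FluidPDE.IsSuitableWeakSolutionOn (Literature.Analysis.FluidPDE.slab (EuclideanSpace ℝ (Fin 3)) (Set.Iio 0) isOpen_Iio) 1 0 u p → Literature.Analysis.FluidPDE.HasWeakSpatialGradientOn (Literature.Analysis.FluidPDE.slab (EuclideanSpace ℝ (Fin 3)) (Set.Iio 0) isOpen_Iio) u G → Literature.Analysis.FluidPDE.typeIBound (Set.Iio (0 : ℝ) ×ˢ Set.univ) u p G < ⊤ → Literature.Analysis.FluidPDE.HasTypeIDecay C u → Literature.Analysis.FluidPDE.IsBackwardSingularPoint u 0 → 1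 < c → (∀ x : EuclideanSpace ℝ (Fin 3), R x = Q (Literature.Analysis.FluidPDE.rotZ θ (Q.symm x))) → Function.uncurry (fun t x => R (Literature.Analysis.FluidPDE.nsRescale c u t (R.symm x))) =ᵐ[MeasureTheory.volume.restrict (Set.Iio (0 : ℝ) ×ˢ Set.univ)] Function.uncurry u → ∃ (C' : ℝ) (u : ℝ → EuclideanSpace ℝ (Fin 3) → EuclideanSpace ℝ (Fin 3)) (p : ℝ → EuclideanSpace ℝ (Fin 3) → ℝ) (G : ℝ → EuclideanSpace ℝ (Fin 3) → EuclideanSpace ℝ (Fin 3) →L[ℝ] EuclideanSpace ℝ (Fin 3)), Literature.Analysis.FluidPDE.IsSuitableWeakSolutionOn (Literature.Analysis.FluidPDE.slab (EuclideanSpace ℝ (Fin 3)) (Set.Iio 0) isOpen_Iio) 1 0 u p ∧ Literature.Analysis.FluidPDE.HasWeakSpatialGradientOn (Literature.Analysis.FluidPDE.slab (EuclideanSpace ℝ (Fin 3)) (Set.Iio 0) isOpen_Iio) u G ∧ Literature.Analysis.FluidPDE.typeIBound (Set.Iio (0 : ℝ) ×ˢ Set.univ) u p G < ⊤ ∧ Literature.Analysis.FluidPDE.HasTypeIDecay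 C' u ∧ Literature.Analysis.FluidPDE.IsBackwardSingularPoint u 0 ∧ ((∃ c θ : ℝ, 1 < c ∧ ∀ K : Set (EuclideanSpace ℝ (Fin 3)), IsCompact K → (0 : EuclideanSpace ℝ (Fin 3)) ∉ K → Filter.Tendsto (fun δ : ℝ => MeasureTheory.eLpNorm (Function.uncurry (fun t x => Literature.Analysis.FluidPDE.rotZ θ (Literature.Analysis.FluidPDE.nsRescale c u t (Literature.Analysis.FluidPDE.rotZ (-θ) x))) - Function.uncurry u) ⊤ (MeasureTheory.volume.restrict (Set.Ioo (-δ) 0 ×ˢ K))) (nhdsWithin 0 (Set.Ioi 0)) (nhds 0)) ∨ (∀ θ : ℝ, ∀ K : Set (EuclideanSpace ℝ (Fin 3)), IsCompact K → (0 : EuclideanSpace ℝ (Fin 3)) ∉ K → Filter.Tendsto (fun δ : ℝ => MeasureTheory.eLpNorm (Function.uncurry (fun t x => Literature.Analysis.FluidPDE.rotZ θ (u t (Literature.Analysis.FluidPDE.rotZ (-θ) x))) - Function.uncurry u) ⊤ (MeasureTheory.volume.restrict (Set.Ioo (-δ) 0 ×ˢ K))) (nhdsWithin 0 (Set.Ioi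 0)) (nhds 0))) :=
  Summit.NavierStokesRegularity.NavierStokesRegularity.Theorems.SymmetricScarExists.RdssSplit.AnyAxis.stub_anyAxisScrewWitness

/-- AUX-6 `stub_irrationalScarRotation` — **an apex scar fixed by a rotation of irrational angle is
axisymmetric** (scar-level twin of AUX-1): the scar of an apex profile is an honest continuous field `σ` off
the origin (`ScarWindow.stub_apexScarTrace`, via the mild representative), `SameScar (conjZ φ u) u` iff
`R_φ σ(R_{−φ} x) = σ x` off the origin, so the scar stabiliser (a subgroup: `sameScar_conjZ_add/neg`) is
CLOSED; containing `θ` and `2π` with `θ/2π ∉ ℚ` it is `ℝ` (`AxiScar u`). [folklore] -/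
theorem stub_irrationalScarRotation :
    ∀ (u : ℝ → EuclideanSpace ℝ (Fin 3) → EuclideanSpace ℝ (Fin 3)) (p : ℝ → EuclideanSpace ℝ (Fin 3) → ℝ) (G : ℝ → EuclideanSpace ℝ (Fin 3) → EuclideanSpace ℝ (Fin 3) →L[ℝ] EuclideanSpace ℝ (Fin 3)) (C θ : ℝ), 0 < C → Literature.Analysis.FluidPDE.IsSuitableWeakSolutionOn (Literature.Analysis.FluidPDE.slab (EuclideanSpace ℝ (Fin 3)) (Set.Iio 0) isOpen_Iio) 1 0 u p → Literature.Analysis.FluidPDE.HasWeakSpatialGradientOn (Literature.Analysis.FluidPDE.slab (EuclideanSpace ℝ (Fin 3)) (Set.Iio 0) isOpen_Iio) u G → Literature.Analysis.FluidPDE.typeIBound (Set.Iio (0 : ℝ) ×ˢ Set.univ) u p G < ⊤ → Literature.Analysis.FluidPDE.HasTypeIDecay C u → Irrational (θ / (2 * Real.pi)) → (∀ K : Set (EuclideanSpace ℝ (Fin 3)), IsCompact K → (0 : EuclideanSpace ℝ (Fin 3)) ∉ K → Filter.Tendsto (fun δ : ℝ => MeasureTheory.eLpNorm (Function.uncurry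 (fun t x => Literature.Analysis.FluidPDE.rotZ θ (u t (Literature.Analysis.FluidPDE.rotZ (-θ) x))) - Function.uncurry u) ⊤ (MeasureTheory.volume.restrict (Set.Ioo (-δ) 0 ×ˢ K))) (nhdsWithin 0 (Set.Ioi 0)) (nhds 0)) → ∀ φ : ℝ, ∀ K : Set (EuclideanSpace ℝ (Fin 3)), IsCompact K → (0 : EuclideanSpace ℝ (Fin 3)) ∉ K → Filter.Tendsto (fun δ : ℝ => MeasureTheory.eLpNorm (Function.uncurry (fun t x => Literature.Analysis.FluidPDE.rotZ φ (u t (Literature.Analysis.FluidPDE.rotZ (-φ) x))) - Function.uncurry u) ⊤ (MeasureTheory.volume.restrict (Set.Ioo (-δ) 0 ×ˢ K))) (nhdsWithin 0 (Set.Ioi 0)) (nhds 0) :=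
  Summit.NavierStokesRegularity.NavierStokesRegularity.Theorems.SymmetricScarExists.RdssSplit.ScarLevel.stub_irrationalScarRotation

/-! ## Auxiliary registered stubs, wave 3 (lead c4): the scar stabiliser in the screw group is CLOSED

AUX-6 proved that the rotation stabiliser of an apex scar is closed; AUX-7 is the same for the full screw group
`ℝ₊ × SO(2)` (dilations move the scar continuously too: `rate_nsRescale`), and AUX-8 is the plane-group fact that
turns closedness into structure: a closed subgroup of `ℝ²` is discrete at `0` or contains a line.  The lead's
assembly below (`scarStabiliser_dichotomy`) converts them into the DICHOTOMY "isolated identity (screw-periodic scar)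
or one-parameter symmetry (spiral / homogeneous / axisymmetric scar)", and shows that an ACCUMULATING selection —
child A with screws tending to the identity — closes the repaired crux `SymmetricScarExistsSpiral` outright. -/

/-- AUX-7 `stub_scarStabiliserClosed` — **the scar stabiliser of an apex profile is closed in the screw group
`ℝ₊ × SO(2)`**: if the screws `(c_j, θ_j) → (c₀, θ₀)` (`c_j, c₀ > 0`) all fix the scar of `u`, so does `(c₀, θ₀)`
(mild representative, scar with the cubic rate `stub_apexScarTrace`, `static_limit_eq_zero_of_flat` along the sequence,
`tendsto_eLpNorm_top_of_rate`; the rotation-only case is the landed `ScarLevel.irrScarRot_isClosed_stabiliser_apex`). [folklore] -/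
theorem stub_scarStabiliserClosed :
    ∀ (u : ℝ → EuclideanSpace ℝ (Fin 3) → EuclideanSpace ℝ (Fin 3)) (p : ℝ → EuclideanSpace ℝ (Fin 3) → ℝ) (G : ℝ → EuclideanSpace ℝ (Fin 3) → EuclideanSpace ℝ (Fin 3) →L[ℝ] EuclideanSpace ℝ (Fin 3)) (C : ℝ), 0 < C → Literature.Analysis.FluidPDE.IsSuitableWeakSolutionOn (Literature.Analysis.FluidPDE.slab (EuclideanSpace ℝ (Fin 3)) (Set.Iio 0) isOpen_Iio) 1 0 u p → Literature.Analysis.FluidPDE.HasWeakSpatialGradientOn (Literature.Analysis.FluidPDE.slab (EuclideanSpace ℝ (Fin 3)) (Set.Iio 0) isOpen_Iio) u G → Literature.Analysis.FluidPDE.typeIBound (Set.Iio (0 : ℝ) ×ˢ Set.univ) u p G < ⊤ → Literature.Analysis.FluidPDE.HasTypeIDecay C u → ∀ (c θ : ℕ → ℝ) (c₀ θ₀ : ℝ), (∀ j : ℕ, 0 < c j) → 0 < c₀ → Filter.Tendsto c Filter.atTop (nhds c₀) → Filter.Tendsto θ Filter.atTop (nhds θ₀) → (∀ j : ℕ, ∀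 K : Set (EuclideanSpace ℝ (Fin 3)), IsCompact K → (0 : EuclideanSpace ℝ (Fin 3)) ∉ K → Filter.Tendsto (fun δ : ℝ => MeasureTheory.eLpNorm (Function.uncurry (fun t x => Literature.Analysis.FluidPDE.rotZ (θ j) (Literature.Analysis.FluidPDE.nsRescale (c j) u t (Literature.Analysis.FluidPDE.rotZ (-(θ j)) x))) - Function.uncurry u) ⊤ (MeasureTheory.volume.restrict (Set.Ioo (-δ) 0 ×ˢ K))) (nhdsWithin 0 (Set.Ioi 0)) (nhds 0)) → ∀ K : Set (EuclideanSpace ℝ (Fin 3)), IsCompact K → (0 : EuclideanSpace ℝ (Fin 3)) ∉ K → Filter.Tendsto (fun δ : ℝ => MeasureTheory.eLpNorm (Function.uncurry (fun t x => Literature.Analysis.FluidPDE.rotZ θ₀ (Literature.Analysis.FluidPDE.nsRescale c₀ u t (Literature.Analysis.FluidPDE.rotZ (-θ₀) x))) - Function.uncurry u) ⊤ (MeasureTheory.volume.restrict (Set.Ioo (-δ) 0 ×ˢ K))) (nhdsWithin 0 (Set.Ioi 0)) (nhds 0) :=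
  Summit.NavierStokesRegularity.NavierStokesRegularity.Theorems.SymmetricScarExists.RdssSplit.ScarLevel.stub_scarStabiliserClosed

/-- AUX-8 `stub_closedSubgroupPlane_line` — **a closed additive subgroup of the plane in which `0` is not isolated
contains a line through `0`** (directions of short nonzero elements subconverge on the unit sphere; integer multiples
of the short elements approximate every point of the limit line; closedness). [folklore] -/
theorem stub_closedSubgroupPlane_line :
    ∀ S : AddSubgroup (ℝ × ℝ), IsClosed (S : Set (ℝ × ℝ)) → (∀ ε : ℝ, 0 < ε → ∃ s : ℝ × ℝ, s ∈ S ∧ s ≠ 0 ∧ ‖s‖ < ε) → ∃ v : ℝ × ℝ, v ≠ 0 ∧ ∀ t : ℝ, t • v ∈ S :=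
  Summit.NavierStokesRegularity.NavierStokesRegularity.Theorems.SymmetricScarExists.RdssSplit.ScarLevel.stub_closedSubgroupPlane_line

/-! ## Auxiliary registered stubs, wave 4 (lead c4): moving angles

AUX-9 (rotation orbit continuity in `L³_loc`) and AUX-10 (AUX-3 with a convergent angle `θ_j → θ₀`) upgrade the
fatal RAYS of T4 to fatal BOXES `(1, c⋆) × (θ₀ − η, θ₀ + η)` around every irrational direction (T6 below). -/

/-- AUX-9 `stub_rotationOrbitContinuity` — **the rotation orbit `θ ↦ R_θ u(t, R_{−θ}x)` is continuous in
`L³(Q(0,R))`** at a field with `u ∈ L³(Q(0,R))` for every `R` (sequential form): the `3ε` argument of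
`stub_rlOrbitContinuous` with the measure-preserving rotation of `Q(0,R)` in place of the zoom (approximate by a
continuous compactly supported field, uniform continuity, `rlRotAbs_eLpNorm_conj`). [folklore] -/
theorem stub_rotationOrbitContinuity :
    ∀ (u : ℝ → EuclideanSpace ℝ (Fin 3) → EuclideanSpace ℝ (Fin 3)), (∀ R : ℝ, 0 < R → MeasureTheory.MemLp (Function.uncurry u) 3 (MeasureTheory.volume.restrict (Literature.Analysis.FluidPDE.parabolicCylinder R (0 : ℝ × EuclideanSpace ℝ (Fin 3))))) → ∀ (θ : ℕ → ℝ) (θ₀ : ℝ), Filter.Tendsto θ Filter.atTop (nhds θ₀) → ∀ R : ℝ, 0 < R → Filter.Tendsto (fun j : ℕ => MeasureTheory.eLpNorm (Function.uncurry (fun t x => Literature.Analysis.FluidPDE.rotZ (θ j) (u t (Literature.Analysis.FluidPDE.rotZ (-(θ j)) x))) - Function.uncurry (fun t x => Literature.Analysis.FluidPDE.rotZ θ₀ (u t (Literature.Analysis.FluidPDE.rotZ (-θ₀) x)))) 3 (MeasureTheory.volume.restrict (Literature.Analysis.FluidPDE.parabolicCylinder R (0 : ℝ × EuclideanSpace ℝ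 (Fin 3))))) Filter.atTop (nhds 0) :=
  Summit.NavierStokesRegularity.NavierStokesRegularity.Theorems.SymmetricScarExists.RdssSplit.NearIdentity.stub_rotationOrbitContinuity

/-- AUX-10 `stub_screwInvariantLimitMoving` — **screw invariance with `(c_j, θ_j) → (1, θ₀)` becomes
`R_{θ₀}`-invariance in the `L³_loc` limit** (AUX-3 with a moving angle): five terms on each ball,
`‖R_{θ₀}u − u‖ ≤ ‖R_{θ₀}u − R_{θ_j}u‖ + ‖u − D_{c_j}u‖ + c_j(c_j⁵)^{-1/3}‖u − V_j‖_{Q(0,c_jR)} + 0 + ‖V_j − u‖ → 0`,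
then exhaustion of the slab. [folklore] -/
theorem stub_screwInvariantLimitMoving :
    ∀ (θ : ℕ → ℝ) (θ₀ : ℝ) (c : ℕ → ℝ) (V : ℕ → ℝ → EuclideanSpace ℝ (Fin 3) → EuclideanSpace ℝ (Fin 3)) (u : ℝ → EuclideanSpace ℝ (Fin 3) → EuclideanSpace ℝ (Fin 3)), (∀ j : ℕ, 0 < c j) → Filter.Tendsto c Filter.atTop (nhds 1) → Filter.Tendsto θ Filter.atTop (nhds θ₀) → (∀ (j : ℕ) (r : ℝ), 0 < r → ∀ R : ℝ, 0 < R → MeasureTheory.AEStronglyMeasurable (Function.uncurry (Literature.Analysis.FluidPDE.nsRescale r (V j))) (MeasureTheory.volume.restrict (Literature.Analysis.FluidPDE.parabolicCylinder R (0 : ℝ × EuclideanSpace ℝ (Fin 3))))) → (∀ (r : ℝ), 0 < r → ∀ R : ℝ, 0 < R → MeasureTheory.AEStronglyMeasurable (Function.uncurry (Literature.Analysis.FluidPDE.nsRescale r u)) (MeasureTheory.volume.restrict (Literature.Analysis.FluidPDE.parabolicCylinder R (0 : ℝ × EuclideanSpace ℝ (Fin 3))))) → (∀ R : ℝ, 0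 < R → Filter.Tendsto (fun j : ℕ => MeasureTheory.eLpNorm (Function.uncurry (V j) - Function.uncurry u) 3 (MeasureTheory.volume.restrict (Literature.Analysis.FluidPDE.parabolicCylinder R (0 : ℝ × EuclideanSpace ℝ (Fin 3))))) Filter.atTop (nhds 0)) → (∀ R : ℝ, 0 < R → Filter.Tendsto (fun j : ℕ => MeasureTheory.eLpNorm (Function.uncurry (Literature.Analysis.FluidPDE.nsRescale (c j) u) - Function.uncurry u) 3 (MeasureTheory.volume.restrict (Literature.Analysis.FluidPDE.parabolicCylinder R (0 : ℝ × EuclideanSpace ℝ (Fin 3))))) Filter.atTop (nhds 0)) → (∀ R : ℝ, 0 < R → Filter.Tendsto (fun j : ℕ => MeasureTheory.eLpNorm (Function.uncurry (fun t x => Literature.Analysis.FluidPDE.rotZ (θ j) (u t (Literature.Analysis.FluidPDE.rotZ (-(θ j)) x))) - Function.uncurry (fun t x => Literature.Analysis.FluidPDE.rotZ θ₀ (u t (Literature.Analysis.FluidPDE.rotZ (-θ₀) x)))) 3 (MeasureTheory.volume.restrict (Literature.Analysis.FluidPDE.parabolicCylinder R (0 : ℝ × EuclideanSpace ℝ (Fin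 3))))) Filter.atTop (nhds 0)) → (∀ j : ℕ, Function.uncurry (fun t x => Literature.Analysis.FluidPDE.rotZ (θ j) (Literature.Analysis.FluidPDE.nsRescale (c j) (V j) t (Literature.Analysis.FluidPDE.rotZ (-(θ j)) x))) =ᵐ[MeasureTheory.volume.restrict (Set.Iio (0 : ℝ) ×ˢ Set.univ)] Function.uncurry (V j)) → Function.uncurry (fun t x => Literature.Analysis.FluidPDE.rotZ θ₀ (u t (Literature.Analysis.FluidPDE.rotZ (-θ₀) x))) =ᵐ[MeasureTheory.volume.restrict (Set.Iio (0 : ℝ) ×ˢ Set.univ)] Function.uncurry u :=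
  Summit.NavierStokesRegularity.NavierStokesRegularity.Theorems.SymmetricScarExists.RdssSplit.NearIdentity.stub_screwInvariantLimitMoving

/-! ## Lead's assembly (c4): every screw DIRECTION is fatal near the identity

`rdssApexFatal_irrationalAngle_nearOne` (T4) composes AUX-2, AUX-3, AUX-1 with the quantitative slab
compactness `Robust.slabLimit_le`; `rdssApexFatal_anyAngle_nearOne` (T5) adds the landed rational corner
`Calibration.rdssApexFatal_rationalAngle_nearOne`.  Net: for every `C`, every `I < ⊤` and EVERY angle `θ` there
is `c⋆ = c⋆(C, I, θ) > 1` such that child C holds at the screw `(c, θ)` for all `1 < c < c⋆` in the class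
`𝐈 ≤ I` — the near-identity corner of the wall in every direction of the screw group, beyond the cones
`|θ| ≲ log c` of Pineau–Vicol and the rational directions. -/

/-- Measurability of the rescaled slab profiles on the backward balls (bookkeeping for AUX-3). [folklore] -/
theorem aestronglyMeasurable_nsRescale_slabProfile
    {u : ℝ → EuclideanSpace ℝ (Fin 3) → EuclideanSpace ℝ (Fin 3)} {p : ℝ → EuclideanSpace ℝ (Fin 3) → ℝ}
    {G : ℝ → EuclideanSpace ℝ (Fin 3) → EuclideanSpace ℝ (Fin 3) →L[ℝ] EuclideanSpace ℝ (Fin 3)}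
    (hsw : IsSuitableWeakSolutionOn (slab (EuclideanSpace ℝ (Fin 3)) (Iio (0 : ℝ)) isOpen_Iio) 1 0 u p)
    (hwg : HasWeakSpatialGradientOn (slab (EuclideanSpace ℝ (Fin 3)) (Iio (0 : ℝ)) isOpen_Iio) u G) :
    ∀ r : ℝ, 0 < r → ∀ R : ℝ, 0 < R → AEStronglyMeasurable (uncurry (nsRescale r u))
      (volume.restrict (parabolicCylinder R (0 : ℝ × EuclideanSpace ℝ (Fin 3)))) := by
  intro r hr R _
  rw [Summit.NavierStokesRegularity.NavierStokesRegularity.Theorems.nsRescale_eq_zoom]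
  exact (Summit.NavierStokesRegularity.NavierStokesRegularity.Theorems.zoom_slabProfile hsw hwg hr).2.1
    |>.locallyIntegrableOn.aestronglyMeasurable.mono_measure
      (Measure.restrict_mono (parabolicCylinder_origin_subset_slab _) le_rfl)

/-- **T4 — an IRRATIONAL screw direction is fatal near the identity.**  For every `C`, every `I < ⊤` and every
angle `θ` with `θ/2π ∉ ℚ` there is `c⋆ > 1` such that no suitable weak solution on the slab with a weak gradient,
`𝐈 ≤ I`, the apex bound of constant `C` and a singular origin is a.e. fixed by the screw `(c, θ)` with
`1 < c < c⋆`.  Otherwise factors `c_k ↓ 1` carry such profiles `v_k`; a subsequence converges in `L³_loc`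
(`slabLimit_le`) to a singular apex profile `u`, the dilations `D_{c_k} u → u` (AUX-2), so `u` is a.e. fixed by
the pure rotation `R_θ` (AUX-3), which AUX-1 forbids. [folklore] -/
theorem rdssApexFatal_irrationalAngle_nearOne :
    ∀ (C : ℝ) (I : ℝ≥0∞) (θ : ℝ), I < ⊤ → Irrational (θ / (2 * Real.pi)) →
      ∃ cstar : ℝ, 1 < cstar ∧ ∀ c : ℝ, 1 < c → c < cstar →
        ∀ (u : ℝ → EuclideanSpace ℝ (Fin 3) → EuclideanSpace ℝ (Fin 3)) (p : ℝ → EuclideanSpace ℝ (Fin 3) → ℝ)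
          (G : ℝ → EuclideanSpace ℝ (Fin 3) → EuclideanSpace ℝ (Fin 3) →L[ℝ] EuclideanSpace ℝ (Fin 3)),
          IsSuitableWeakSolutionOn (slab (EuclideanSpace ℝ (Fin 3)) (Iio (0 : ℝ)) isOpen_Iio) 1 0 u p →
          HasWeakSpatialGradientOn (slab (EuclideanSpace ℝ (Fin 3)) (Iio (0 : ℝ)) isOpen_Iio) u G →
          typeIBound (Iio (0 : ℝ) ×ˢ univ) u p G ≤ I → HasTypeIDecay C u → IsBackwardSingularPoint u 0 →
          uncurry (fun t x => rotZ θ (nsRescale c u t (rotZ (-θ) x)))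
            =ᵐ[volume.restrict (Iio (0 : ℝ) ×ˢ (univ : Set (EuclideanSpace ℝ (Fin 3))))] uncurry u → False := by
  intro C I θ hI hirr
  rcases lt_or_ge C 0 with hC | hC
  · -- a negative constant: the class is empty
    refine ⟨2, one_lt_two, fun c _ _ u p G _ _ _ hdec _ _ => ?_⟩
    have h := hdec (-1) (by norm_num) 0
    rw [norm_zero, neg_neg, Real.sqrt_one, zero_add, div_one] at h
    linarith [norm_nonneg (u (-1) 0)]
  by_contra hcon
  push Not at hcon
  have hpos : ∀ k : ℕ, (1 : ℝ) < 1 + 1 / ((k : ℝ) + 1) := fun k => by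
    have : (0 : ℝ) < 1 / ((k : ℝ) + 1) := by positivity
    linarith
  choose c hc1 hck v q H hsw hwg hIk hdec hsing hinv using fun k : ℕ => hcon _ (hpos k)
  have hc0 : ∀ k, 0 < c k := fun k => one_pos.trans (hc1 k)
  -- `c_k → 1`
  have hc_tend : Tendsto c atTop (𝓝 1) := by
    have h1 : Tendsto (fun k : ℕ => (1 : ℝ) + 1 / ((k : ℝ) + 1)) atTop (𝓝 1) := by
      have h := (tendsto_one_div_add_atTop_nhds_zero_nat).const_add (1 : ℝ)
      rwa [add_zero] at h
    exact tendsto_of_tendsto_of_tendsto_of_le_of_le tendsto_const_nhds h1 (fun k => (hc1 k).le)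
      (fun k => (hck k).le)
  -- ## compactness: a singular apex `L³_loc` limit along `φ`
  obtain ⟨u, p, G, φ, hφ, hswu, hwgu, hIu, hdecu, hsingu, hconv⟩ :=
    Summit.NavierStokesRegularity.NavierStokesRegularity.Theorems.SymmetricScarExists.RdssSplit.Robust.slabLimit_le
      C I v q H hC hI (fun k => ⟨hsw k, hwg k, hIk k, hdec k, hsing k⟩)
  have hI4 : 4 * I < ⊤ := ENNReal.mul_lt_top (by simp) hI
  have hIu' : typeIBound (Iio (0 : ℝ) ×ˢ univ) u p G < ⊤ := lt_of_le_of_lt hIu hI4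
  -- ## AUX-2: the dilations `D_{c_{φ j}} u → u` in every `L³(Q(0,R))`
  have hmem : ∀ R : ℝ, 0 < R → MemLp (uncurry u) 3
      (volume.restrict (parabolicCylinder R (0 : ℝ × EuclideanSpace ℝ (Fin 3)))) :=
    fun R hR => Summit.NavierStokesRegularity.NavierStokesRegularity.Theorems.memLp_three_of_slabProfile hwgu hIu' hR
  have hcφ0 : ∀ j : ℕ, 0 < c (φ j) := fun j => hc0 (φ j)
  have hcφ : Tendsto (fun j => c (φ j)) atTop (𝓝 1) := hc_tend.comp hφ.tendsto_atTop
  have hdil := stub_dilationContinuity u hmem (fun j => c (φ j)) hcφ0 hcφ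
  -- ## AUX-3: the limit is a.e. fixed by the pure rotation `R_θ`
  have hVm : ∀ (j : ℕ) (r : ℝ), 0 < r → ∀ R : ℝ, 0 < R →
      AEStronglyMeasurable (uncurry (nsRescale r (v (φ j))))
        (volume.restrict (parabolicCylinder R (0 : ℝ × EuclideanSpace ℝ (Fin 3)))) :=
    fun j => aestronglyMeasurable_nsRescale_slabProfile (hsw (φ j)) (hwg (φ j))
  have hum := aestronglyMeasurable_nsRescale_slabProfile hswu hwgu
  have hrot := stub_rotInvariantLimit θ (fun j => c (φ j)) (fun j => v (φ j)) u hcφ0 hcφ hVm hum hconv hdil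
    (fun j => (hinv (φ j)).1)
  -- ## AUX-1: an irrationally rotation-invariant singular apex profile does not exist
  exact stub_irrationalRotationApexFatal u p G C θ hswu hwgu hIu' hdecu hsingu hirr hrot

/-- **T5 — EVERY screw direction is fatal near the identity.**  For every `C`, every `I < ⊤` and every angle
`θ` there is `c⋆ > 1` such that child C holds at `(c, θ)` for `1 < c < c⋆` in the class `𝐈 ≤ I`: irrational
directions by T4; a rational direction `θ/2π = m/q` by the landed rational corner (the `q`-th power of the screw
is the untwisted dilation by `c^q < c₁`, Chae–Wolf), with `c⋆ = c₁^{1/q}`. [cite: ChaeWolf2017RemovingDSS, Theorem 1.3 (arXiv:1610.09464 p. 3)] -/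
theorem rdssApexFatal_anyAngle_nearOne :
    ∀ (C : ℝ) (I : ℝ≥0∞) (θ : ℝ), I < ⊤ →
      ∃ cstar : ℝ, 1 < cstar ∧ ∀ c : ℝ, 1 < c → c < cstar →
        ∀ (u : ℝ → EuclideanSpace ℝ (Fin 3) → EuclideanSpace ℝ (Fin 3)) (p : ℝ → EuclideanSpace ℝ (Fin 3) → ℝ)
          (G : ℝ → EuclideanSpace ℝ (Fin 3) → EuclideanSpace ℝ (Fin 3) →L[ℝ] EuclideanSpace ℝ (Fin 3)),
          IsSuitableWeakSolutionOn (slab (EuclideanSpace ℝ (Fin 3)) (Iio (0 : ℝ)) isOpen_Iio) 1 0 u p →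
          HasWeakSpatialGradientOn (slab (EuclideanSpace ℝ (Fin 3)) (Iio (0 : ℝ)) isOpen_Iio) u G →
          typeIBound (Iio (0 : ℝ) ×ˢ univ) u p G ≤ I → HasTypeIDecay C u → IsBackwardSingularPoint u 0 →
          uncurry (fun t x => rotZ θ (nsRescale c u t (rotZ (-θ) x)))
            =ᵐ[volume.restrict (Iio (0 : ℝ) ×ˢ (univ : Set (EuclideanSpace ℝ (Fin 3))))] uncurry u → False := by
  intro C I θ hI
  by_cases hirr : Irrational (θ / (2 * Real.pi))
  · exact rdssApexFatal_irrationalAngle_nearOne C I θ hI hirr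
  rcases le_or_gt C 0 with hC | hC
  · -- a nonpositive constant: the field vanishes on the slab, the origin is not singular
    refine ⟨2, one_lt_two, fun c _ _ u p G _ _ _ hdec hsing _ => ?_⟩
    refine Summit.NavierStokesRegularity.NavierStokesRegularity.Theorems.SymmetricScarExists.ScarWindow.not_isBackwardSingularPoint_of_ae_zero_slab (u := u) ?_ hsing
    filter_upwards [ae_restrict_mem (measurableSet_Iio.prod MeasurableSet.univ)] with w hw
    exact Summit.NavierStokesRegularity.NavierStokesRegularity.Theorems.SymmetricScarExists.ScarWindow.eq_zero_of_hasTypeIDecay_nonpos hC hdec hw.1 w.2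
  -- a rational direction `θ / 2π = r`
  unfold Irrational at hirr
  push Not at hirr
  obtain ⟨r, hr⟩ := hirr
  obtain ⟨c₁, hc₁, Hrat⟩ :=
    Summit.NavierStokesRegularity.NavierStokesRegularity.Theorems.SymmetricScarExists.RdssSplit.Calibration.rdssApexFatal_rationalAngle_nearOne C hC
  have hden : (0 : ℝ) < r.den := by exact_mod_cast r.den_pos
  have hqθ : (r.den : ℝ) * θ = 2 * Real.pi * r.num := by
    have hπ : (2 * Real.pi) ≠ 0 := by positivity
    have e : θ = 2 * Real.pi * (r : ℝ) := by
      rw [hr]; field_simp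
    rw [e, Rat.cast_def]
    field_simp
  refine ⟨c₁ ^ (1 / (r.den : ℝ)), Real.one_lt_rpow hc₁ (by positivity), fun c hc hcc u p G hsw hwg hIle hdec hsing hinv => ?_⟩
  have hcq : c ^ r.den < c₁ := by
    have h1 : c ^ r.den < (c₁ ^ (1 / (r.den : ℝ))) ^ r.den :=
      pow_lt_pow_left₀ hcc (zero_le_one.trans hc.le) r.den_pos.ne'
    have h2 : (c₁ ^ (1 / (r.den : ℝ))) ^ r.den = c₁ := by
      rw [← Real.rpow_natCast, ← Real.rpow_mul (zero_le_one.trans hc₁.le), one_div_mul_cancel hden.ne',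
        Real.rpow_one]
    rwa [h2] at h1
  exact Hrat c θ r.den r.num r.den_pos hqθ hc hcq u p G hsw hwg (lt_of_le_of_lt hIle hI) hdec hsing hinv

/-- **Inheritance from powers**: a profile a.e. fixed by the screw `(c, θ)` (`c > 0`) is a.e. fixed by its powers
`(cⁿ, nθ)`; so fatality of `(cⁿ, nθ)` in some class implies fatality of `(c, θ)` in the same class. [folklore] -/
theorem rdssInvariant_pow {u : ℝ → EuclideanSpace ℝ (Fin 3) → EuclideanSpace ℝ (Fin 3)} {c θ : ℝ} (hc : 0 < c)
    (h : uncurry (fun t x => rotZ θ (nsRescale c u t (rotZ (-θ) x)))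
      =ᵐ[volume.restrict (Iio (0 : ℝ) ×ˢ (univ : Set (EuclideanSpace ℝ (Fin 3))))] uncurry u) (n : ℕ) :
    uncurry (fun t x => rotZ ((n : ℝ) * θ) (nsRescale (c ^ n) u t (rotZ (-((n : ℝ) * θ)) x)))
      =ᵐ[volume.restrict (Iio (0 : ℝ) ×ˢ (univ : Set (EuclideanSpace ℝ (Fin 3))))] uncurry u :=
  Summit.NavierStokesRegularity.NavierStokesRegularity.Theorems.SymmetricScarExists.RdssSplit.Calibration.ae_screw_pow hc h n

/-! ## Lead's assembly (c4, wave 3): the scar stabiliser dichotomy -/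

/-- The scar stabiliser of `u` in logarithmic coordinates `(a, θ) ↦ (e^a, θ)` of the screw group: the set of
`(a, θ)` with `SameScar (R_θ D_{e^a} u) u`, as an additive subgroup of `ℝ × ℝ` (the screws commute,
`nsRescale_conjZ`, compose by `screw_screw`, and `SameScar` is an equivalence relation covariant under screws). [folklore] -/
theorem scarStabiliser_addSubgroup (u : ℝ → EuclideanSpace ℝ (Fin 3) → EuclideanSpace ℝ (Fin 3)) :
    ∃ S : AddSubgroup (ℝ × ℝ), ∀ s : ℝ × ℝ, s ∈ S ↔ SameScar (conjZ s.2 (nsRescale (Real.exp s.1) u)) u := by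
  refine ⟨{ carrier := {s : ℝ × ℝ | SameScar (conjZ s.2 (nsRescale (Real.exp s.1) u)) u}
            add_mem' := ?_, zero_mem' := ?_, neg_mem' := ?_ }, fun s => Iff.rfl⟩
  · rintro ⟨a, θ⟩ ⟨b, φ⟩ ha hb
    simp only [mem_setOf_eq, Prod.fst_add, Prod.snd_add] at ha hb ⊢
    -- R_{θ+φ} D_{e^{a+b}} u = R_θ D_{e^a} (R_φ D_{e^b} u)
    have e : conjZ (θ + φ) (nsRescale (Real.exp (a + b)) u) =
        conjZ θ (nsRescale (Real.exp a) (conjZ φ (nsRescale (Real.exp b) u))) := by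
      rw [Real.exp_add,
        Summit.NavierStokesRegularity.NavierStokesRegularity.Theorems.SymmetricScarExists.RdssSplit.Orbit.screw_screw]
    rw [e]
    exact sameScar_trans (sameScar_conjZ θ (sameScar_nsRescale hb (Real.exp_pos a))) ha
  · simp only [mem_setOf_eq, Prod.fst_zero, Prod.snd_zero, Real.exp_zero, nsRescale_one, conjZ_zero]
    exact sameScar_refl u
  · rintro ⟨a, θ⟩ ha
    simp only [mem_setOf_eq, Prod.fst_neg, Prod.snd_neg] at ha ⊢
    -- apply the inverse screw to both sides of `ha`
    have h := sameScar_conjZ (-θ) (sameScar_nsRescale ha (Real.exp_pos (-a)))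
    have e : conjZ (-θ) (nsRescale (Real.exp (-a)) (conjZ θ (nsRescale (Real.exp a) u))) = u := by
      have h1 : Real.exp (-a) * Real.exp a = 1 := by rw [← Real.exp_add, neg_add_cancel, Real.exp_zero]
      rw [Summit.NavierStokesRegularity.NavierStokesRegularity.Theorems.SymmetricScarExists.RdssSplit.Orbit.screw_screw,
        h1, nsRescale_one, neg_add_cancel, conjZ_zero]
    rw [e] at h
    exact sameScar_symm h

/-- **The scar stabiliser dichotomy** (lead c4, from AUX-7 + AUX-8).  For an apex profile with constant `C > 0`:
EITHER the identity is isolated among the screws `(e^a, θ)` fixing its scar (the stabiliser is discrete at the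
identity — the genuinely screw-PERIODIC case, where child C needs the RDSS Liouville theorem for the isolated screw),
OR the scar is fixed by a whole one-parameter subgroup of `ℝ₊ × SO(2)`: a SPIRAL scar `SpiralScar α u` (pitch
`α`; `α = 0` is the homogeneous scar `HomScar`) or an axisymmetric scar `AxiScar u` — the conclusion of the repaired
crux `SymmetricScarExistsSpiral`. [folklore] -/
theorem scarStabiliser_dichotomy
    (u : ℝ → EuclideanSpace ℝ (Fin 3) → EuclideanSpace ℝ (Fin 3)) (p : ℝ → EuclideanSpace ℝ (Fin 3) → ℝ)
    (G : ℝ → EuclideanSpace ℝ (Fin 3) → EuclideanSpace ℝ (Fin 3) →L[ℝ] EuclideanSpace ℝ (Fin 3)) (C : ℝ) (hC : 0 < C)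
    (hsw : IsSuitableWeakSolutionOn (slab (EuclideanSpace ℝ (Fin 3)) (Iio (0 : ℝ)) isOpen_Iio) 1 0 u p)
    (hwg : HasWeakSpatialGradientOn (slab (EuclideanSpace ℝ (Fin 3)) (Iio (0 : ℝ)) isOpen_Iio) u G)
    (hI : typeIBound (Iio (0 : ℝ) ×ˢ univ) u p G < ⊤) (hdec : HasTypeIDecay C u) :
    (∃ ε : ℝ, 0 < ε ∧ ∀ a θ : ℝ, SameScar (conjZ θ (nsRescale (Real.exp a) u)) u → (a, θ) ≠ (0, 0) → ε ≤ ‖(a, θ)‖) ∨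
      ((∃ α : ℝ, SpiralScar α u) ∨ AxiScar u) := by
  obtain ⟨S, hS⟩ := scarStabiliser_addSubgroup u
  by_cases hiso : ∃ ε : ℝ, 0 < ε ∧ ∀ s : ℝ × ℝ, s ∈ S → s ≠ 0 → ε ≤ ‖s‖
  · left
    obtain ⟨ε, hε, h⟩ := hiso
    exact ⟨ε, hε, fun a θ hs hne => h (a, θ) ((hS _).2 hs) hne⟩
  · right
    push Not at hiso
    -- the stabiliser is closed (AUX-7, sequentially)
    have hclosed : IsClosed (S : Set (ℝ × ℝ)) := by
      refine IsSeqClosed.isClosed fun s s₀ hs hlim => ?_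
      rw [SetLike.mem_coe, hS]
      exact stub_scarStabiliserClosed u p G C hC hsw hwg hI hdec (fun j => Real.exp (s j).1) (fun j => (s j).2)
        (Real.exp s₀.1) s₀.2 (fun j => Real.exp_pos _) (Real.exp_pos _)
        ((Real.continuous_exp.tendsto _).comp ((continuous_fst.tendsto _).comp hlim))
        ((continuous_snd.tendsto _).comp hlim) (fun j => (hS _).1 (hs j))
    -- hence contains a line (AUX-8)
    obtain ⟨⟨v₁, v₂⟩, hv, hline⟩ := stub_closedSubgroupPlane_line S hclosed
      (fun ε hε => by
        obtain ⟨s, hsS, hs0, hsε⟩ := hiso ε hε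
        exact ⟨s, hsS, hs0, hsε⟩)
    have hmem : ∀ t : ℝ, SameScar (conjZ (t * v₂) (nsRescale (Real.exp (t * v₁)) u)) u := fun t => by
      have h := (hS _).1 (hline t)
      simpa only [Prod.smul_mk, smul_eq_mul] using h
    by_cases hv₁ : v₁ = 0
    · -- the line is the rotation axis of the group: axisymmetric scar
      subst hv₁
      have hv₂ : v₂ ≠ 0 := by
        rintro rfl
        exact hv rfl
      right
      intro φ
      have h := hmem (φ / v₂)
      rwa [mul_zero, Real.exp_zero, nsRescale_one, div_mul_cancel₀ φ hv₂] at h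
    · -- a transversal line: spiral scar of pitch `v₂ / (2 v₁)`
      left
      refine ⟨v₂ / (2 * v₁), fun lam hlam => ?_⟩
      have h := hmem (Real.log lam / v₁)
      have e1 : Real.log lam / v₁ * v₁ = Real.log lam := div_mul_cancel₀ _ hv₁
      rw [e1, Real.exp_log hlam] at h
      have e2 : 2 * (v₂ / (2 * v₁)) * Real.log lam = Real.log lam / v₁ * v₂ := by
        field_simp
      rwa [e2]

/-- **An ACCUMULATING selection closes the repaired crux** `SymmetricScarExistsSpiral`: if from every singular apex
profile one can produce a singular apex profile (constant `C'`) whose scar is fixed by screws `(e^a, θ) ≠ (1, 0)`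
arbitrarily close to the identity, then the repaired crux holds (by the dichotomy; `C' > 0` is forced by the
singularity). [folklore] -/
theorem symmetricScarExistsSpiral_of_accumulatingSelection
    (hAcc : ∀ C : ℝ, (∃ (u : ℝ → EuclideanSpace ℝ (Fin 3) → EuclideanSpace ℝ (Fin 3)) (p : ℝ → EuclideanSpace ℝ (Fin 3) → ℝ) (G : ℝ → EuclideanSpace ℝ (Fin 3) → EuclideanSpace ℝ (Fin 3) →L[ℝ] EuclideanSpace ℝ (Fin 3)), IsSuitableWeakSolutionOn (slab (EuclideanSpace ℝ (Fin 3)) (Iio (0 : ℝ)) isOpen_Iio) 1 0 u p ∧ HasWeakSpatialGradientOn (slab (EuclideanSpace ℝ (Fin 3)) (Iio (0 : ℝ)) isOpen_Iio) u G ∧ typeIBound (Iio (0 : ℝ) ×ˢ univ) u p G < ⊤ ∧ HasTypeIDecay C u ∧ IsBackwardSingularPoint u 0) →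
      ∃ (C' : ℝ) (u : ℝ → EuclideanSpace ℝ (Fin 3) → EuclideanSpace ℝ (Fin 3)) (p : ℝ → EuclideanSpace ℝ (Fin 3) → ℝ) (G : ℝ → EuclideanSpace ℝ (Fin 3) → EuclideanSpace ℝ (Fin 3) →L[ℝ] EuclideanSpace ℝ (Fin 3)), IsSuitableWeakSolutionOn (slab (EuclideanSpace ℝ (Fin 3)) (Iio (0 : ℝ)) isOpen_Iio) 1 0 u p ∧ HasWeakSpatialGradientOn (slab (EuclideanSpace ℝ (Fin 3)) (Iio (0 : ℝ)) isOpen_Iio) u G ∧ typeIBound (Iio (0 : ℝ) ×ˢ univ) u p G < ⊤ ∧ HasTypeIDecay C' u ∧ IsBackwardSingularPoint u 0 ∧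
        ∀ ε : ℝ, 0 < ε → ∃ a θ : ℝ, SameScar (conjZ θ (nsRescale (Real.exp a) u)) u ∧ (a, θ) ≠ (0, 0) ∧ ‖(a, θ)‖ < ε) :
    SymmetricScarExistsSpiral := by
  intro C hex
  obtain ⟨C', u, p, G, hsw, hwg, hI, hdec, hsing, hacc⟩ := hAcc C hex
  have hC' : 0 < C' := by
    by_contra hle
    push Not at hle
    refine Summit.NavierStokesRegularity.NavierStokesRegularity.Theorems.SymmetricScarExists.ScarWindow.not_isBackwardSingularPoint_of_ae_zero_slab (u := u) ?_ hsing
    filter_upwards [ae_restrict_mem (measurableSet_Iio.prod MeasurableSet.univ)] with w hw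
    exact Summit.NavierStokesRegularity.NavierStokesRegularity.Theorems.SymmetricScarExists.ScarWindow.eq_zero_of_hasTypeIDecay_nonpos hle hdec hw.1 w.2
  refine ⟨C', u, p, G, hsw, hwg, hI, hdec, hsing, ?_⟩
  rcases scarStabiliser_dichotomy u p G C' hC' hsw hwg hI hdec with ⟨ε, hε, hfar⟩ | h
  · exfalso
    obtain ⟨a, θ, hs, hne, hlt⟩ := hacc ε hε
    exact (not_le.2 hlt) (hfar a θ hs hne)
  · exact h

/-- **What an accumulating selection buys the route** (readback): granted `ScarRigidity` and the rotated self-similar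
Liouville theorems `RssApexFatal α` for every pitch (Pineau–Vicol 2026 Conj. 1.1; proved for small and large `|α|`),
an accumulating selection yields the route target `NoApexTypeIProfile` — via the repaired crux and the landed
`Negative.noApexTypeIProfile_of_repaired`, `similarityCovariance_proof`, `rellichScar_axisymmetricApexFatal_proof`.
[cite: PineauVicol2026, Conjecture 1.1 and Remark 1.5 (arXiv:2607.09619 pp. 3, 5)] -/
theorem noApexTypeIProfile_of_accumulatingSelection (hSR : ScarRigidity) (hRss : ∀ α : ℝ, RssApexFatal α)
    (hAcc : ∀ C : ℝ, (∃ (u : ℝ → EuclideanSpace ℝ (Fin 3) → EuclideanSpace ℝ (Fin 3)) (p : ℝ → EuclideanSpace ℝ (Fin 3) → ℝ) (G : ℝ → EuclideanSpace ℝ (Fin 3) → EuclideanSpace ℝ (Fin 3) →L[ℝ] EuclideanSpace ℝ (Fin 3)), IsSuitableWeakSolutionOn (slab (EuclideanSpace ℝ (Fin 3)) (Iio (0 : ℝ)) isOpen_Iio) 1 0 u p ∧ HasWeakSpatialGradientOn (slab (EuclideanSpace ℝ (Fin 3)) (Iio (0 : ℝ)) isOpen_Iio) u G ∧ typeIBound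 (Iio (0 : ℝ) ×ˢ univ) u p G < ⊤ ∧ HasTypeIDecay C u ∧ IsBackwardSingularPoint u 0) →
      ∃ (C' : ℝ) (u : ℝ → EuclideanSpace ℝ (Fin 3) → EuclideanSpace ℝ (Fin 3)) (p : ℝ → EuclideanSpace ℝ (Fin 3) → ℝ) (G : ℝ → EuclideanSpace ℝ (Fin 3) → EuclideanSpace ℝ (Fin 3) →L[ℝ] EuclideanSpace ℝ (Fin 3)), IsSuitableWeakSolutionOn (slab (EuclideanSpace ℝ (Fin 3)) (Iio (0 : ℝ)) isOpen_Iio) 1 0 u p ∧ HasWeakSpatialGradientOn (slab (EuclideanSpace ℝ (Fin 3)) (Iio (0 : ℝ)) isOpen_Iio) u G ∧ typeIBound (Iio (0 : ℝ) ×ˢ univ) u p G < ⊤ ∧ HasTypeIDecay C' u ∧ IsBackwardSingularPoint u 0 ∧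
        ∀ ε : ℝ, 0 < ε → ∃ a θ : ℝ, SameScar (conjZ θ (nsRescale (Real.exp a) u)) u ∧ (a, θ) ≠ (0, 0) ∧ ‖(a, θ)‖ < ε) :
    NoApexTypeIProfile :=
  noApexTypeIProfile_of_repaired hSR (symmetricScarExistsSpiral_of_accumulatingSelection hAcc)
    Summit.NavierStokesRegularity.NavierStokesRegularity.Theorems.RellichScarSimilarityCovariance.similarityCovariance_proof
    hRss Summit.NavierStokesRegularity.NavierStokesRegularity.Theorems.rellichScar_axisymmetricApexFatal_proof


/-! ## Lead's assembly (c4, wave 4): open boxes of fatal screws around irrational directions -/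

/-- **T6 — open BOXES of fatal screws around every irrational direction.**  For every `C`, every `I < ⊤` and
every angle `θ₀` with `θ₀/2π ∉ ℚ` there are `c⋆ > 1` and `η > 0` such that no suitable weak solution on the slab with
a weak gradient, `𝐈 ≤ I`, the apex bound of constant `C` and a singular origin is a.e. fixed by a screw `(c, θ)` with
`1 < c < c⋆`, `|θ − θ₀| < η`: otherwise screws `(c_k, θ_k) → (1, θ₀)` carry such profiles, a subsequence converges in
`L³_loc` (`slabLimit_le`) to a singular apex profile `u`, whose dilation and rotation orbits are continuous in `L³_loc`
(AUX-2, AUX-9), so `u` is a.e. fixed by `R_{θ₀}` (AUX-10), which AUX-1 forbids.  Hence near the identity the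
possibly non-fatal screws are confined to cusps at the rational directions `θ ∈ 2πℚ` (whose rays are themselves fatal
for `c^q < c₁`, `rdssApexFatal_rationalAngle_nearOne`). [folklore] -/
theorem rdssApexFatal_nearIrrationalDirection :
    ∀ (C : ℝ) (I : ℝ≥0∞) (θ₀ : ℝ), I < ⊤ → Irrational (θ₀ / (2 * Real.pi)) →
      ∃ cstar η : ℝ, 1 < cstar ∧ 0 < η ∧ ∀ c θ : ℝ, 1 < c → c < cstar → |θ - θ₀| < η →
        ∀ (u : ℝ → EuclideanSpace ℝ (Fin 3) → EuclideanSpace ℝ (Fin 3)) (p : ℝ → EuclideanSpace ℝ (Fin 3) → ℝ)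
          (G : ℝ → EuclideanSpace ℝ (Fin 3) → EuclideanSpace ℝ (Fin 3) →L[ℝ] EuclideanSpace ℝ (Fin 3)),
          IsSuitableWeakSolutionOn (slab (EuclideanSpace ℝ (Fin 3)) (Iio (0 : ℝ)) isOpen_Iio) 1 0 u p →
          HasWeakSpatialGradientOn (slab (EuclideanSpace ℝ (Fin 3)) (Iio (0 : ℝ)) isOpen_Iio) u G →
          typeIBound (Iio (0 : ℝ) ×ˢ univ) u p G ≤ I → HasTypeIDecay C u → IsBackwardSingularPoint u 0 →
          uncurry (fun t x => rotZ θ (nsRescale c u t (rotZ (-θ) x)))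
            =ᵐ[volume.restrict (Iio (0 : ℝ) ×ˢ (univ : Set (EuclideanSpace ℝ (Fin 3))))] uncurry u → False := by
  intro C I θ₀ hI hirr
  rcases lt_or_ge C 0 with hC | hC
  · refine ⟨2, 1, one_lt_two, one_pos, fun c θ _ _ _ u p G _ _ _ hdec _ _ => ?_⟩
    have h := hdec (-1) (by norm_num) 0
    rw [norm_zero, neg_neg, Real.sqrt_one, zero_add, div_one] at h
    linarith [norm_nonneg (u (-1) 0)]
  by_contra hcon
  push Not at hcon
  have hpos : ∀ k : ℕ, (0 : ℝ) < 1 / ((k : ℝ) + 1) := fun k => by positivity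
  choose c θ hc1 hck hθk v q H hsw hwg hIk hdec hsing hinv using
    fun k : ℕ => hcon (1 + 1 / ((k : ℝ) + 1)) (1 / ((k : ℝ) + 1)) (by linarith [hpos k]) (hpos k)
  have hc0 : ∀ k, 0 < c k := fun k => one_pos.trans (hc1 k)
  have h1k : Tendsto (fun k : ℕ => (1 : ℝ) / ((k : ℝ) + 1)) atTop (𝓝 0) := tendsto_one_div_add_atTop_nhds_zero_nat
  -- `c_k → 1`, `θ_k → θ₀`
  have hc_tend : Tendsto c atTop (𝓝 1) := by
    have h1 : Tendsto (fun k : ℕ => (1 : ℝ) + 1 / ((k : ℝ) + 1)) atTop (𝓝 1) := by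
      have h := h1k.const_add (1 : ℝ)
      rwa [add_zero] at h
    exact tendsto_of_tendsto_of_tendsto_of_le_of_le tendsto_const_nhds h1 (fun k => (hc1 k).le)
      (fun k => (hck k).le)
  have hθ_tend : Tendsto θ atTop (𝓝 θ₀) := by
    rw [tendsto_iff_norm_sub_tendsto_zero]
    refine squeeze_zero (fun k => norm_nonneg _) (fun k => ?_) h1k
    rw [Real.norm_eq_abs]
    exact (hθk k).le
  -- ## compactness
  obtain ⟨u, p, G, φ, hφ, hswu, hwgu, hIu, hdecu, hsingu, hconv⟩ :=
    Summit.NavierStokesRegularity.NavierStokesRegularity.Theorems.SymmetricScarExists.RdssSplit.Robust.slabLimit_le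
      C I v q H hC hI (fun k => ⟨hsw k, hwg k, hIk k, hdec k, hsing k⟩)
  have hI4 : 4 * I < ⊤ := ENNReal.mul_lt_top (by simp) hI
  have hIu' : typeIBound (Iio (0 : ℝ) ×ˢ univ) u p G < ⊤ := lt_of_le_of_lt hIu hI4
  have hmem : ∀ R : ℝ, 0 < R → MemLp (uncurry u) 3
      (volume.restrict (parabolicCylinder R (0 : ℝ × EuclideanSpace ℝ (Fin 3)))) :=
    fun R hR => Summit.NavierStokesRegularity.NavierStokesRegularity.Theorems.memLp_three_of_slabProfile hwgu hIu' hR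
  have hcφ0 : ∀ j : ℕ, 0 < c (φ j) := fun j => hc0 (φ j)
  have hcφ : Tendsto (fun j => c (φ j)) atTop (𝓝 1) := hc_tend.comp hφ.tendsto_atTop
  have hθφ : Tendsto (fun j => θ (φ j)) atTop (𝓝 θ₀) := hθ_tend.comp hφ.tendsto_atTop
  -- ## AUX-2 / AUX-9: the dilation and rotation orbits of the limit are continuous
  have hdil := Summit.NavierStokesRegularity.NavierStokesRegularity.Theorems.SymmetricScarExists.RdssSplit.NearIdentity.stub_dilationContinuity
    u hmem (fun j => c (φ j)) hcφ0 hcφ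
  have hrot := stub_rotationOrbitContinuity u hmem (fun j => θ (φ j)) θ₀ hθφ
  -- ## AUX-10: the limit is a.e. fixed by `R_{θ₀}`
  have hVm : ∀ (j : ℕ) (r : ℝ), 0 < r → ∀ R : ℝ, 0 < R →
      AEStronglyMeasurable (uncurry (nsRescale r (v (φ j))))
        (volume.restrict (parabolicCylinder R (0 : ℝ × EuclideanSpace ℝ (Fin 3)))) :=
    fun j => aestronglyMeasurable_nsRescale_slabProfile (hsw (φ j)) (hwg (φ j))
  have hum := aestronglyMeasurable_nsRescale_slabProfile hswu hwgu
  have hfix := stub_screwInvariantLimitMoving (fun j => θ (φ j)) θ₀ (fun j => c (φ j)) (fun j => v (φ j)) u hcφ0 hcφ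
    hθφ hVm hum hconv hdil hrot (fun j => (hinv (φ j)).1)
  -- ## AUX-1
  exact Summit.NavierStokesRegularity.NavierStokesRegularity.Theorems.SymmetricScarExists.RdssSplit.NearIdentity.stub_irrationalRotationApexFatal
    u p G C θ₀ hswu hwgu hIu' hdecu hsingu hirr hfix

/-- **Optimality of the per-direction statement** (readback): a UNIFORM near-identity corner — one `Λ(C, I) > 1` fatal
for ALL angles at once — already implies the rotated self-similar Liouville theorems `RssApexFatal α` for EVERY pitch
(Pineau–Vicol 2026, Conj. 1.1, open for `α ≈ 1`): an a.e. `α`-RSS profile is a.e. fixed by the screws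
`(λ, 2α log λ)` with `λ ↓ 1`.  So `rdssApexFatal_anyAngle_nearOne` / `rdssApexFatal_nearIrrationalDirection` are the
unconditional shadow of that conjecture near the identity. [cite: PineauVicol2026, Conjecture 1.1 (arXiv:2607.09619 p. 3)] -/
theorem rssApexFatal_of_uniformNearIdentity
    (hU : ∀ (C : ℝ) (I : ℝ≥0∞), I < ⊤ → ∃ Λ : ℝ, 1 < Λ ∧ ∀ c θ : ℝ, 1 < c → c < Λ →
      ∀ (u : ℝ → EuclideanSpace ℝ (Fin 3) → EuclideanSpace ℝ (Fin 3)) (p : ℝ → EuclideanSpace ℝ (Fin 3) → ℝ)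
        (G : ℝ → EuclideanSpace ℝ (Fin 3) → EuclideanSpace ℝ (Fin 3) →L[ℝ] EuclideanSpace ℝ (Fin 3)),
        IsSuitableWeakSolutionOn (slab (EuclideanSpace ℝ (Fin 3)) (Iio (0 : ℝ)) isOpen_Iio) 1 0 u p →
        HasWeakSpatialGradientOn (slab (EuclideanSpace ℝ (Fin 3)) (Iio (0 : ℝ)) isOpen_Iio) u G →
        typeIBound (Iio (0 : ℝ) ×ˢ univ) u p G ≤ I → HasTypeIDecay C u → IsBackwardSingularPoint u 0 →
        uncurry (fun t x => rotZ θ (nsRescale c u t (rotZ (-θ) x)))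
          =ᵐ[volume.restrict (Iio (0 : ℝ) ×ˢ (univ : Set (EuclideanSpace ℝ (Fin 3))))] uncurry u → False) :
    ∀ α : ℝ, RssApexFatal α := by
  intro α u p G C hsw hwg hI hdec hsing hrss
  obtain ⟨Λ, hΛ, hfatal⟩ := hU C (typeIBound (Iio (0 : ℝ) ×ˢ univ) u p G) hI
  -- a factor `λ ∈ (1, Λ)`
  set lam : ℝ := (1 + Λ) / 2 with hlam
  have h1 : 1 < lam := by rw [hlam]; linarith
  have h2 : lam < Λ := by rw [hlam]; linarith
  exact hfatal lam (2 * α * Real.log lam) h1 h2 u p G hsw hwg le_rfl hdec hsing (hrss lam (one_pos.trans h1))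

/-! ## Compositions (sorry-free modulo the stubs) -/

/-- **The crux BY NAME from stubs A, B, C** — the split glue: given `C` and a singular apex profile, A yields a
singular apex profile (constant `C'`) with a screw-fixed scar or an axisymmetric scar; in the first case B makes
it a.e. screw-invariant and C yields `False`; in the second it is a witness of the crux's axisymmetric
alternative verbatim. [folklore] -/
theorem SymmetricScarExists_of :
    (∀ C : ℝ, (∃ (u : ℝ → EuclideanSpace ℝ (Fin 3) → EuclideanSpace ℝ (Fin 3)) (p : ℝ → EuclideanSpace ℝ (Fin 3) → ℝ) (G : ℝ → EuclideanSpace ℝ (Fin 3) → EuclideanSpace ℝ (Fin 3) →L[ℝ] EuclideanSpace ℝ (Fin 3)), Literature.Analysis.FluidPDE.IsSuitableWeakSolutionOn (Literature.Analysis.FluidPDE.slab (EuclideanSpace ℝ (Fin 3)) (Set.Iio 0) isOpen_Iio) 1 0 u p ∧ Literature.Analysis.FluidPDE.HasWeakSpatialGradientOn (Literature.Analysis.FluidPDE.slab (EuclideanSpace ℝ (Fin 3)) (Set.Iio 0) isOpen_Iio) u G ∧ Literature.Analysis.FluidPDE.typeIBound (Set.Iio (0 : ℝ) ×ˢ Set.univ)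 u p G < ⊤ ∧ Literature.Analysis.FluidPDE.HasTypeIDecay C u ∧ Literature.Analysis.FluidPDE.IsBackwardSingularPoint u 0) → ∃ (C' : ℝ) (u : ℝ → EuclideanSpace ℝ (Fin 3) → EuclideanSpace ℝ (Fin 3)) (p : ℝ → EuclideanSpace ℝ (Fin 3) → ℝ) (G : ℝ → EuclideanSpace ℝ (Fin 3) → EuclideanSpace ℝ (Fin 3) →L[ℝ] EuclideanSpace ℝ (Fin 3)), Literature.Analysis.FluidPDE.IsSuitableWeakSolutionOn (Literature.Analysis.FluidPDE.slab (EuclideanSpace ℝ (Fin 3)) (Set.Iio 0) isOpen_Iio) 1 0 u p ∧ Literature.Analysis.FluidPDE.HasWeakSpatialGradientOn (Literature.Analysis.FluidPDE.slab (EuclideanSpace ℝ (Fin 3)) (Set.Iio 0) isOpen_Iio) u G ∧ Literature.Analysis.FluidPDE.typeIBound (Set.Iio (0 : ℝ) ×ˢ Set.univ) u p G < ⊤ ∧ Literature.Analysis.FluidPDE.HasTypeIDecay C' u ∧ Literature.Analysis.FluidPDE.IsBackwardSingularPoint u 0 ∧ ((∃ c θ : ℝ, 1 < c ∧ ∀ K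 : Set (EuclideanSpace ℝ (Fin 3)), IsCompact K → (0 : EuclideanSpace ℝ (Fin 3)) ∉ K → Filter.Tendsto (fun δ : ℝ => MeasureTheory.eLpNorm (Function.uncurry (fun t x => Literature.Analysis.FluidPDE.rotZ θ (Literature.Analysis.FluidPDE.nsRescale c u t (Literature.Analysis.FluidPDE.rotZ (-θ) x))) - Function.uncurry u) ⊤ (MeasureTheory.volume.restrict (Set.Ioo (-δ) 0 ×ˢ K))) (nhdsWithin 0 (Set.Ioi 0)) (nhds 0)) ∨ (∀ θ : ℝ, ∀ K : Set (EuclideanSpace ℝ (Fin 3)), IsCompact K → (0 : EuclideanSpace ℝ (Fin 3)) ∉ K → Filter.Tendsto (fun δ : ℝ => MeasureTheory.eLpNorm (Function.uncurry (fun t x => Literature.Analysis.FluidPDE.rotZ θ (u t (Literature.Analysis.FluidPDE.rotZ (-θ) x))) - Function.uncurry u) ⊤ (MeasureTheory.volume.restrict (Set.Ioo (-δ) 0 ×ˢ K))) (nhdsWithin 0 (Set.Ioi 0)) (nhds 0)))) →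
    (∀ (u : ℝ → EuclideanSpace ℝ (Fin 3) → EuclideanSpace ℝ (Fin 3)) (p : ℝ → EuclideanSpace ℝ (Fin 3) → ℝ) (G : ℝ → EuclideanSpace ℝ (Fin 3) → EuclideanSpace ℝ (Fin 3) →L[ℝ] EuclideanSpace ℝ (Fin 3)) (C c θ : ℝ), Literature.Analysis.FluidPDE.IsSuitableWeakSolutionOn (Literature.Analysis.FluidPDE.slab (EuclideanSpace ℝ (Fin 3)) (Set.Iio 0) isOpen_Iio) 1 0 u p → Literature.Analysis.FluidPDE.HasWeakSpatialGradientOn (Literature.Analysis.FluidPDE.slab (EuclideanSpace ℝ (Fin 3)) (Set.Iio 0) isOpen_Iio) u G → Literature.Analysis.FluidPDE.typeIBound (Set.Iio (0 : ℝ) ×ˢ Set.univ) u p G < ⊤ → Literature.Analysis.FluidPDE.HasTypeIDecay C u → Literature.Analysis.FluidPDE.IsBackwardSingularPoint u 0 → 1 < c → (∀ K : Set (EuclideanSpace ℝ (Fin 3)), IsCompact K → (0 : EuclideanSpace ℝ (Fin 3)) ∉ K → Filter.Tendsto (fun δ : ℝ => MeasureTheory.eLpNorm (Function.uncurry (fun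 t x => Literature.Analysis.FluidPDE.rotZ θ (Literature.Analysis.FluidPDE.nsRescale c u t (Literature.Analysis.FluidPDE.rotZ (-θ) x))) - Function.uncurry u) ⊤ (MeasureTheory.volume.restrict (Set.Ioo (-δ) 0 ×ˢ K))) (nhdsWithin 0 (Set.Ioi 0)) (nhds 0)) → Function.uncurry (fun t x => Literature.Analysis.FluidPDE.rotZ θ (Literature.Analysis.FluidPDE.nsRescale c u t (Literature.Analysis.FluidPDE.rotZ (-θ) x))) =ᵐ[MeasureTheory.volume.restrict (Set.Iio (0 : ℝ) ×ˢ Set.univ)] Function.uncurry u) →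
    (∀ (u : ℝ → EuclideanSpace ℝ (Fin 3) → EuclideanSpace ℝ (Fin 3)) (p : ℝ → EuclideanSpace ℝ (Fin 3) → ℝ) (G : ℝ → EuclideanSpace ℝ (Fin 3) → EuclideanSpace ℝ (Fin 3) →L[ℝ] EuclideanSpace ℝ (Fin 3)) (C c θ : ℝ), Literature.Analysis.FluidPDE.IsSuitableWeakSolutionOn (Literature.Analysis.FluidPDE.slab (EuclideanSpace ℝ (Fin 3)) (Set.Iio 0) isOpen_Iio) 1 0 u p → Literature.Analysis.FluidPDE.HasWeakSpatialGradientOn (Literature.Analysis.FluidPDE.slab (EuclideanSpace ℝ (Fin 3)) (Set.Iio 0) isOpen_Iio) u G → Literature.Analysis.FluidPDE.typeIBound (Set.Iio (0 : ℝ) ×ˢ Set.univ) u p G < ⊤ → Literature.Analysis.FluidPDE.HasTypeIDecay C u → Literature.Analysis.FluidPDE.IsBackwardSingularPoint u 0 → 1 < c → Function.uncurry (fun t x => Literature.Analysis.FluidPDE.rotZ θ (Literature.Analysis.FluidPDE.nsRescale c u t (Literature.Analysis.FluidPDE.rotZ (-θ) x))) =ᵐ[MeasureTheory.volume.restrict (Set.Iio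 (0 : ℝ) ×ˢ Set.univ)] Function.uncurry u → False) →
    SymmetricScarExists := by
  intro hSel hRig hFatal C hex
  obtain ⟨C', u, p, G, hsw, hwg, hI, hdec, hsing, hsym⟩ := hSel C hex
  rcases hsym with ⟨c, θ, hc, hscar⟩ | hax
  · exact (hFatal u p G C' c θ hsw hwg hI hdec hsing hc
      (hRig u p G C' c θ hsw hwg hI hdec hsing hc hscar)).elim
  · exact ⟨C', u, p, G, hsw, hwg, hI, hdec, hsing, Or.inr hax⟩

/-- The composition instantiated on the stubs: the crux, sorry-free modulo A, B, C. -/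
theorem symmetricScarExists_proof : SymmetricScarExists :=
  SymmetricScarExists_of stub_rdssScarSelection stub_rdssScarRigidity stub_rdssApexFatal

/-! ## Calibrations (proved): each child is weaker than an existing route statement -/

/-- The untwisted screw-dilation is the plain rescaling. [folklore] -/
theorem screw_zero_twist_eq (c : ℝ) (u : ℝ → EuclideanSpace ℝ (Fin 3) → EuclideanSpace ℝ (Fin 3)) :
    (fun t x => rotZ 0 (nsRescale c u t (rotZ (-0) x))) = nsRescale c u := by
  funext t x
  simp only [neg_zero, rotZ_zero]

/-- **A is weaker than the crux**: `SymmetricScarExists → A` (a homogeneous scar is fixed by `(2, 0)`).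
[folklore] -/
theorem rdssScarSelection_of_symmetricScarExists (hS : SymmetricScarExists) :
    ∀ C : ℝ, (∃ (u : ℝ → EuclideanSpace ℝ (Fin 3) → EuclideanSpace ℝ (Fin 3)) (p : ℝ → EuclideanSpace ℝ (Fin 3) → ℝ) (G : ℝ → EuclideanSpace ℝ (Fin 3) → EuclideanSpace ℝ (Fin 3) →L[ℝ] EuclideanSpace ℝ (Fin 3)), Literature.Analysis.FluidPDE.IsSuitableWeakSolutionOn (Literature.Analysis.FluidPDE.slab (EuclideanSpace ℝ (Fin 3)) (Set.Iio 0) isOpen_Iio) 1 0 u p ∧ Literature.Analysis.FluidPDE.HasWeakSpatialGradientOn (Literature.Analysis.FluidPDE.slab (EuclideanSpace ℝ (Fin 3)) (Set.Iio 0) isOpen_Iio) u G ∧ Literature.Analysis.FluidPDE.typeIBound (Set.Iio (0 : ℝ) ×ˢ Set.univ) u p G < ⊤ ∧ Literature.Analysis.FluidPDE.HasTypeIDecay C u ∧ Literature.Analysis.FluidPDE.IsBackwardSingularPoint u 0) → ∃ (C' : ℝ) (u : ℝ → EuclideanSpace ℝ (Fin 3) → EuclideanSpace ℝ (Fin 3))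 (p : ℝ → EuclideanSpace ℝ (Fin 3) → ℝ) (G : ℝ → EuclideanSpace ℝ (Fin 3) → EuclideanSpace ℝ (Fin 3) →L[ℝ] EuclideanSpace ℝ (Fin 3)), Literature.Analysis.FluidPDE.IsSuitableWeakSolutionOn (Literature.Analysis.FluidPDE.slab (EuclideanSpace ℝ (Fin 3)) (Set.Iio 0) isOpen_Iio) 1 0 u p ∧ Literature.Analysis.FluidPDE.HasWeakSpatialGradientOn (Literature.Analysis.FluidPDE.slab (EuclideanSpace ℝ (Fin 3)) (Set.Iio 0) isOpen_Iio) u G ∧ Literature.Analysis.FluidPDE.typeIBound (Set.Iio (0 : ℝ) ×ˢ Set.univ) u p G < ⊤ ∧ Literature.Analysis.FluidPDE.HasTypeIDecay C' u ∧ Literature.Analysis.FluidPDE.IsBackwardSingularPoint u 0 ∧ ((∃ c θ : ℝ, 1 < c ∧ ∀ K : Set (EuclideanSpace ℝ (Fin 3)), IsCompact K → (0 : EuclideanSpace ℝ (Fin 3)) ∉ K → Filter.Tendsto (fun δ : ℝ => MeasureTheory.eLpNorm (Function.uncurry (fun t x => Literature.Analysis.FluidPDE.rotZ θ (Literature.Analysis.FluidPDE.nsRescale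 c u t (Literature.Analysis.FluidPDE.rotZ (-θ) x))) - Function.uncurry u) ⊤ (MeasureTheory.volume.restrict (Set.Ioo (-δ) 0 ×ˢ K))) (nhdsWithin 0 (Set.Ioi 0)) (nhds 0)) ∨ (∀ θ : ℝ, ∀ K : Set (EuclideanSpace ℝ (Fin 3)), IsCompact K → (0 : EuclideanSpace ℝ (Fin 3)) ∉ K → Filter.Tendsto (fun δ : ℝ => MeasureTheory.eLpNorm (Function.uncurry (fun t x => Literature.Analysis.FluidPDE.rotZ θ (u t (Literature.Analysis.FluidPDE.rotZ (-θ) x))) - Function.uncurry u) ⊤ (MeasureTheory.volume.restrict (Set.Ioo (-δ) 0 ×ˢ K))) (nhdsWithin 0 (Set.Ioi 0)) (nhds 0))) := by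
  intro C hex
  obtain ⟨C', u, p, G, hsw, hwg, hI, hdec, hsing, hsym⟩ := hS C hex
  refine ⟨C', u, p, G, hsw, hwg, hI, hdec, hsing, ?_⟩
  rcases hsym with hhom | hax
  · refine Or.inl ⟨2, 0, one_lt_two, ?_⟩
    rw [screw_zero_twist_eq]
    exact hhom 2 two_pos
  · exact Or.inr hax

/-- **B is weaker than `ScarRigidity`** (covariance discharged by the landed `similarityCovariance_proof`):
`ScarRigidity` applied to the orbit-internal pair `(R_θ D_c u, u)`. [folklore] -/
theorem rdssScarRigidity_of_scarRigidity (hSR : ScarRigidity) :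
    ∀ (u : ℝ → EuclideanSpace ℝ (Fin 3) → EuclideanSpace ℝ (Fin 3)) (p : ℝ → EuclideanSpace ℝ (Fin 3) → ℝ) (G : ℝ → EuclideanSpace ℝ (Fin 3) → EuclideanSpace ℝ (Fin 3) →L[ℝ] EuclideanSpace ℝ (Fin 3)) (C c θ : ℝ), Literature.Analysis.FluidPDE.IsSuitableWeakSolutionOn (Literature.Analysis.FluidPDE.slab (EuclideanSpace ℝ (Fin 3)) (Set.Iio 0) isOpen_Iio) 1 0 u p → Literature.Analysis.FluidPDE.HasWeakSpatialGradientOn (Literature.Analysis.FluidPDE.slab (EuclideanSpace ℝ (Fin 3)) (Set.Iio 0) isOpen_Iio) u G → Literature.Analysis.FluidPDE.typeIBound (Set.Iio (0 : ℝ) ×ˢ Set.univ) u p G < ⊤ → Literature.Analysis.FluidPDE.HasTypeIDecay C u → Literature.Analysis.FluidPDE.IsBackwardSingularPoint u 0 → 1 < c → (∀ K : Set (EuclideanSpace ℝ (Fin 3)), IsCompact K → (0 : EuclideanSpace ℝ (Fin 3)) ∉ K → Filter.Tendsto (fun δ : ℝ => MeasureTheory.eLpNorm (Function.uncurry (fun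 t x => Literature.Analysis.FluidPDE.rotZ θ (Literature.Analysis.FluidPDE.nsRescale c u t (Literature.Analysis.FluidPDE.rotZ (-θ) x))) - Function.uncurry u) ⊤ (MeasureTheory.volume.restrict (Set.Ioo (-δ) 0 ×ˢ K))) (nhdsWithin 0 (Set.Ioi 0)) (nhds 0)) → Function.uncurry (fun t x => Literature.Analysis.FluidPDE.rotZ θ (Literature.Analysis.FluidPDE.nsRescale c u t (Literature.Analysis.FluidPDE.rotZ (-θ) x))) =ᵐ[MeasureTheory.volume.restrict (Set.Iio (0 : ℝ) ×ˢ Set.univ)] Function.uncurry u := by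
  intro u p G C c θ hsw hwg hI hdec hsing hc hscar
  have hCov : SimilarityCovariance :=
    Summit.NavierStokesRegularity.NavierStokesRegularity.Theorems.RellichScarSimilarityCovariance.similarityCovariance_proof
  have hc0 : 0 < c := one_pos.trans hc
  obtain ⟨q₁, H₁, hs₁, hg₁, hI₁, hd₁, hsing₁⟩ := (hCov u p G C hsw hwg hI hdec hsing).1 c hc0
  obtain ⟨q₂, H₂, hs₂, hg₂, hI₂, hd₂, hsing₂⟩ :=
    (hCov (nsRescale c u) q₁ H₁ C hs₁ hg₁ hI₁ hd₁ hsing₁).2 θ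
  exact hSR _ q₂ H₂ u p G C hs₂ hg₂ hI₂ hd₂ hsw hwg hI hdec hsing₂ hsing hscar

/-- **C is weaker than the target**: `NoApexTypeIProfile → C`. [folklore] -/
theorem rdssApexFatal_of_noApexTypeIProfile (hX : NoApexTypeIProfile) :
    ∀ (u : ℝ → EuclideanSpace ℝ (Fin 3) → EuclideanSpace ℝ (Fin 3)) (p : ℝ → EuclideanSpace ℝ (Fin 3) → ℝ) (G : ℝ → EuclideanSpace ℝ (Fin 3) → EuclideanSpace ℝ (Fin 3) →L[ℝ] EuclideanSpace ℝ (Fin 3)) (C c θ : ℝ), Literature.Analysis.FluidPDE.IsSuitableWeakSolutionOn (Literature.Analysis.FluidPDE.slab (EuclideanSpace ℝ (Fin 3)) (Set.Iio 0) isOpen_Iio) 1 0 u p → Literature.Analysis.FluidPDE.HasWeakSpatialGradientOn (Literature.Analysis.FluidPDE.slab (EuclideanSpace ℝ (Fin 3)) (Set.Iio 0) isOpen_Iio) u G → Literature.Analysis.FluidPDE.typeIBound (Set.Iio (0 : ℝ) ×ˢ Set.univ) u p G < ⊤ → Literature.Analysis.FluidPDE.HasTypeIDecay C u → Literature.Analysis.FluidPDE.IsBackwardSingularPoint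 u 0 → 1 < c → Function.uncurry (fun t x => Literature.Analysis.FluidPDE.rotZ θ (Literature.Analysis.FluidPDE.nsRescale c u t (Literature.Analysis.FluidPDE.rotZ (-θ) x))) =ᵐ[MeasureTheory.volume.restrict (Set.Iio (0 : ℝ) ×ˢ Set.univ)] Function.uncurry u → False := by
  intro u p G C c θ hsw hwg hI hdec hsing _ _
  exact hX u p G C hsw hwg hI hdec hsing

/-- **C contains Perelman's RSS problem in apex form**: `C → ∀ α, RssApexFatal α` (an a.e. `α`-RSS profile is
a.e. fixed by the screw-dilation `(2, 2α log 2)`). [cite: PineauVicol2026, Conjecture 1.1 and Remark 1.5 (arXiv:2607.09619 pp. 3, 5)] -/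
theorem rssApexFatal_of_rdssApexFatal
    (hFatal : ∀ (u : ℝ → EuclideanSpace ℝ (Fin 3) → EuclideanSpace ℝ (Fin 3)) (p : ℝ → EuclideanSpace ℝ (Fin 3) → ℝ) (G : ℝ → EuclideanSpace ℝ (Fin 3) → EuclideanSpace ℝ (Fin 3) →L[ℝ] EuclideanSpace ℝ (Fin 3)) (C c θ : ℝ), Literature.Analysis.FluidPDE.IsSuitableWeakSolutionOn (Literature.Analysis.FluidPDE.slab (EuclideanSpace ℝ (Fin 3)) (Set.Iio 0) isOpen_Iio) 1 0 u p → Literature.Analysis.FluidPDE.HasWeakSpatialGradientOn (Literature.Analysis.FluidPDE.slab (EuclideanSpace ℝ (Fin 3)) (Set.Iio 0) isOpen_Iio) u G → Literature.Analysis.FluidPDE.typeIBound (Set.Iio (0 : ℝ) ×ˢ Set.univ) u p G < ⊤ → Literature.Analysis.FluidPDE.HasTypeIDecay C u → Literature.Analysis.FluidPDE.IsBackwardSingularPoint u 0 → 1 < c → Function.uncurry (fun t x => Literature.Analysis.FluidPDE.rotZ θ (Literature.Analysis.FluidPDE.nsRescale c u t (Literature.Analysis.FluidPDE.rotZ (-θ)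 x))) =ᵐ[MeasureTheory.volume.restrict (Set.Iio (0 : ℝ) ×ˢ Set.univ)] Function.uncurry u → False) (α : ℝ) :
    RssApexFatal α := by
  intro u p G C hsw hwg hI hdec hsing hrss
  exact hFatal u p G C 2 (2 * α * Real.log 2) hsw hwg hI hdec hsing one_lt_two (hrss 2 two_pos)

/-- **C kills a.e. self-similar singular apex profiles** (hypothesis of the PROVED support `SelfSimilarApexFatal`;
case `(c, θ) = (2, 0)`). [cite: Tsai1998, Thm 2] -/
theorem selfSimilar_hypothesis_of_rdssApexFatal
    (hFatal : ∀ (u : ℝ → EuclideanSpace ℝ (Fin 3) → EuclideanSpace ℝ (Fin 3)) (p : ℝ → EuclideanSpace ℝ (Fin 3) → ℝ) (G : ℝ → EuclideanSpace ℝ (Fin 3) → EuclideanSpace ℝ (Fin 3) →L[ℝ] EuclideanSpace ℝ (Fin 3)) (C c θ : ℝ), Literature.Analysis.FluidPDE.IsSuitableWeakSolutionOn (Literature.Analysis.FluidPDE.slab (EuclideanSpace ℝ (Fin 3)) (Set.Iio 0) isOpen_Iio) 1 0 u p → Literature.Analysis.FluidPDE.HasWeakSpatialGradientOn (Literature.Analysis.FluidPDE.slab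 (EuclideanSpace ℝ (Fin 3)) (Set.Iio 0) isOpen_Iio) u G → Literature.Analysis.FluidPDE.typeIBound (Set.Iio (0 : ℝ) ×ˢ Set.univ) u p G < ⊤ → Literature.Analysis.FluidPDE.HasTypeIDecay C u → Literature.Analysis.FluidPDE.IsBackwardSingularPoint u 0 → 1 < c → Function.uncurry (fun t x => Literature.Analysis.FluidPDE.rotZ θ (Literature.Analysis.FluidPDE.nsRescale c u t (Literature.Analysis.FluidPDE.rotZ (-θ) x))) =ᵐ[MeasureTheory.volume.restrict (Set.Iio (0 : ℝ) ×ˢ Set.univ)] Function.uncurry u → False)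
    (u : ℝ → EuclideanSpace ℝ (Fin 3) → EuclideanSpace ℝ (Fin 3)) (p : ℝ → EuclideanSpace ℝ (Fin 3) → ℝ)
    (G : ℝ → EuclideanSpace ℝ (Fin 3) → EuclideanSpace ℝ (Fin 3) →L[ℝ] EuclideanSpace ℝ (Fin 3)) (C : ℝ)
    (hsw : IsSuitableWeakSolutionOn (slab (EuclideanSpace ℝ (Fin 3)) (Iio (0 : ℝ)) isOpen_Iio) 1 0 u p)
    (hwg : HasWeakSpatialGradientOn (slab (EuclideanSpace ℝ (Fin 3)) (Iio (0 : ℝ)) isOpen_Iio) u G)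
    (hI : typeIBound (Iio (0 : ℝ) ×ˢ univ) u p G < ⊤) (hdec : HasTypeIDecay C u)
    (hsing : IsBackwardSingularPoint u 0)
    (hss : ∀ lam : ℝ, 0 < lam →
      uncurry (nsRescale lam u) =ᵐ[volume.restrict (Iio (0 : ℝ) ×ˢ (univ : Set (EuclideanSpace ℝ (Fin 3))))] uncurry u) :
    False := by
  refine hFatal u p G C 2 0 hsw hwg hI hdec hsing one_lt_two ?_
  rw [screw_zero_twist_eq]
  exact hss 2 two_pos

/-- **The landed untwisted corner of C** (`dssApexFatal_nearOne`, p105416, Chae–Wolf 2017 Thm 1.3 in the apex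
class): for every `C > 0` there is `c₁ > 1` such that C holds for `θ = 0` and `1 < c < c₁`. [cite: ChaeWolf2017RemovingDSS, Theorem 1.3 (arXiv:1610.09464 p. 3)] -/
theorem rdssApexFatal_corner_untwisted_nearOne :
    ∀ C : ℝ, 0 < C → ∃ c₁ : ℝ, 1 < c₁ ∧ ∀ c : ℝ, 1 < c → c < c₁ →
      ∀ (u : ℝ → EuclideanSpace ℝ (Fin 3) → EuclideanSpace ℝ (Fin 3)) (p : ℝ → EuclideanSpace ℝ (Fin 3) → ℝ)
        (G : ℝ → EuclideanSpace ℝ (Fin 3) → EuclideanSpace ℝ (Fin 3) →L[ℝ] EuclideanSpace ℝ (Fin 3)),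
        IsSuitableWeakSolutionOn (slab (EuclideanSpace ℝ (Fin 3)) (Iio (0 : ℝ)) isOpen_Iio) 1 0 u p →
        HasWeakSpatialGradientOn (slab (EuclideanSpace ℝ (Fin 3)) (Iio (0 : ℝ)) isOpen_Iio) u G →
        typeIBound (Iio (0 : ℝ) ×ˢ univ) u p G < ⊤ → HasTypeIDecay C u → IsBackwardSingularPoint u 0 →
        uncurry (fun t x => rotZ 0 (nsRescale c u t (rotZ (-0) x)))
          =ᵐ[volume.restrict (Iio (0 : ℝ) ×ˢ (univ : Set (EuclideanSpace ℝ (Fin 3))))] uncurry u → False := by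
  intro C hC
  obtain ⟨c₁, hc₁, h⟩ :=
    Summit.NavierStokesRegularity.NavierStokesRegularity.Theorems.SymmetricScarExists.ScarWindow.dssApexFatal_nearOne C hC
  refine ⟨c₁, hc₁, fun c h1 h2 u p G hsw hwg hI hdec hsing hdss => ?_⟩
  rw [screw_zero_twist_eq] at hdss
  exact h c h1 h2 u p G hsw hwg hI hdec hsing hdss

/-- **Readback against the target** (the costume one level down, stated openly): granting `ScarRigidity` and
C, A ⇔ `NoApexTypeIProfile`. [folklore] -/
theorem rdssScarSelection_iff_noApexTypeIProfile (hSR : ScarRigidity)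
    (hFatal : ∀ (u : ℝ → EuclideanSpace ℝ (Fin 3) → EuclideanSpace ℝ (Fin 3)) (p : ℝ → EuclideanSpace ℝ (Fin 3) → ℝ) (G : ℝ → EuclideanSpace ℝ (Fin 3) → EuclideanSpace ℝ (Fin 3) →L[ℝ] EuclideanSpace ℝ (Fin 3)) (C c θ : ℝ), Literature.Analysis.FluidPDE.IsSuitableWeakSolutionOn (Literature.Analysis.FluidPDE.slab (EuclideanSpace ℝ (Fin 3)) (Set.Iio 0) isOpen_Iio) 1 0 u p → Literature.Analysis.FluidPDE.HasWeakSpatialGradientOn (Literature.Analysis.FluidPDE.slab (EuclideanSpace ℝ (Fin 3)) (Set.Iio 0) isOpen_Iio) u G → Literature.Analysis.FluidPDE.typeIBound (Set.Iio (0 : ℝ) ×ˢ Set.univ) u p G < ⊤ → Literature.Analysis.FluidPDE.HasTypeIDecay C u → Literature.Analysis.FluidPDE.IsBackwardSingularPoint u 0 → 1 < c → Function.uncurry (fun t x => Literature.Analysis.FluidPDE.rotZ θ (Literature.Analysis.FluidPDE.nsRescale c u t (Literature.Analysis.FluidPDE.rotZ (-θ) x))) =ᵐ[MeasureTheory.volume.restrict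 (Set.Iio (0 : ℝ) ×ˢ Set.univ)] Function.uncurry u → False) :
    (∀ C : ℝ, (∃ (u : ℝ → EuclideanSpace ℝ (Fin 3) → EuclideanSpace ℝ (Fin 3)) (p : ℝ → EuclideanSpace ℝ (Fin 3) → ℝ) (G : ℝ → EuclideanSpace ℝ (Fin 3) → EuclideanSpace ℝ (Fin 3) →L[ℝ] EuclideanSpace ℝ (Fin 3)), Literature.Analysis.FluidPDE.IsSuitableWeakSolutionOn (Literature.Analysis.FluidPDE.slab (EuclideanSpace ℝ (Fin 3)) (Set.Iio 0) isOpen_Iio) 1 0 u p ∧ Literature.Analysis.FluidPDE.HasWeakSpatialGradientOn (Literature.Analysis.FluidPDE.slab (EuclideanSpace ℝ (Fin 3)) (Set.Iio 0) isOpen_Iio) u G ∧ Literature.Analysis.FluidPDE.typeIBound (Set.Iio (0 : ℝ) ×ˢ Set.univ) u p G < ⊤ ∧ Literature.Analysis.FluidPDE.HasTypeIDecay C u ∧ Literature.Analysis.FluidPDE.IsBackwardSingularPoint u 0) → ∃ (C' : ℝ) (u : ℝ → EuclideanSpace ℝ (Fin 3) → EuclideanSpace ℝ (Fin 3)) (p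 : ℝ → EuclideanSpace ℝ (Fin 3) → ℝ) (G : ℝ → EuclideanSpace ℝ (Fin 3) → EuclideanSpace ℝ (Fin 3) →L[ℝ] EuclideanSpace ℝ (Fin 3)), Literature.Analysis.FluidPDE.IsSuitableWeakSolutionOn (Literature.Analysis.FluidPDE.slab (EuclideanSpace ℝ (Fin 3)) (Set.Iio 0) isOpen_Iio) 1 0 u p ∧ Literature.Analysis.FluidPDE.HasWeakSpatialGradientOn (Literature.Analysis.FluidPDE.slab (EuclideanSpace ℝ (Fin 3)) (Set.Iio 0) isOpen_Iio) u G ∧ Literature.Analysis.FluidPDE.typeIBound (Set.Iio (0 : ℝ) ×ˢ Set.univ) u p G < ⊤ ∧ Literature.Analysis.FluidPDE.HasTypeIDecay C' u ∧ Literature.Analysis.FluidPDE.IsBackwardSingularPoint u 0 ∧ ((∃ c θ : ℝ, 1 < c ∧ ∀ K : Set (EuclideanSpace ℝ (Fin 3)), IsCompact K → (0 : EuclideanSpace ℝ (Fin 3)) ∉ K → Filter.Tendsto (fun δ : ℝ => MeasureTheory.eLpNorm (Function.uncurry (fun t x => Literature.Analysis.FluidPDE.rotZ θ (Literature.Analysis.FluidPDE.nsRescale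 c u t (Literature.Analysis.FluidPDE.rotZ (-θ) x))) - Function.uncurry u) ⊤ (MeasureTheory.volume.restrict (Set.Ioo (-δ) 0 ×ˢ K))) (nhdsWithin 0 (Set.Ioi 0)) (nhds 0)) ∨ (∀ θ : ℝ, ∀ K : Set (EuclideanSpace ℝ (Fin 3)), IsCompact K → (0 : EuclideanSpace ℝ (Fin 3)) ∉ K → Filter.Tendsto (fun δ : ℝ => MeasureTheory.eLpNorm (Function.uncurry (fun t x => Literature.Analysis.FluidPDE.rotZ θ (u t (Literature.Analysis.FluidPDE.rotZ (-θ) x))) - Function.uncurry u) ⊤ (MeasureTheory.volume.restrict (Set.Ioo (-δ) 0 ×ˢ K))) (nhdsWithin 0 (Set.Ioi 0)) (nhds 0)))) ↔ NoApexTypeIProfile := by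
  constructor
  · intro hSel
    have hS : SymmetricScarExists := SymmetricScarExists_of hSel (rdssScarRigidity_of_scarRigidity hSR) hFatal
    exact (symmetricScarExists_iff_noApexTypeIProfile hSR
      Summit.NavierStokesRegularity.NavierStokesRegularity.Theorems.RellichScarSimilarityCovariance.similarityCovariance_proof
      Summit.NavierStokesRegularity.NavierStokesRegularity.Theorems.rellichScar_selfSimilarApexFatal_proof
      Summit.NavierStokesRegularity.NavierStokesRegularity.Theorems.rellichScar_axisymmetricApexFatal_proof).1 hS
  · intro hX
    exact rdssScarSelection_of_symmetricScarExists (symmetricScarExists_of_noApexTypeIProfile hX)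

end Summit.NavierStokesRegularity.NavierStokesRegularity.Cruxes.SymmetricScarExists.RdssScrewSplit

end
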